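import Literature.MathematicalPhysics.QuantumFieldTheory.Balaban1983to89.B10Eq69TorusPullback
import Literature.MathematicalPhysics.QuantumFieldTheory.Balaban1983to89.B10NestedMinimizer
import Literature.MathematicalPhysics.QuantumFieldTheory.Balaban1983to89.B10Eq42TorusConstraint
import Literature.MathematicalPhysics.QuantumFieldTheory.Balaban1983to89.B8Ineq132

/-!
# `Balaban1983to89.B10Eq68TorusRegularity` — [Balaban1985UV3] p. 273 **(68)** «the configuration U_k satisfies the following
# regularity condition on B^j(Λ_j): |U_k(∂p) − 1| < O(1)g_jp(g_j)L^{−2j}» ON THE TORUS CARRIER OF RECORD `T_η = Setup.Site P 0`: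
# the plaquette clause of [7]'s regular space (2) WITH BODY, (68) on `Δ′_j(p′)` FROM MEMBERSHIP IN ITS SCALE-`j` CLAUSE, Sect. D's knit
# with the hypothesis (68) so discharged — and, with gen 58's `B10Eq42TorusConstraint` ((67) from (42)), the ASSEMBLED chain (42) + (2) ⇒
# (69)–(71) —, and the honest transport «(68) from [7] Theorem 1 AT LEVEL j+1» in the cell's `B10NestedMinimizer` vocabulary;
# v1.1 §6: the COVARIANT-DERIVATIVE clause of (2) = [6] (1.9) with body, the FULL space `U_k({Ω_j}, ε₀)` and its gauge invariance;
# v1.2 §7: [4] (11) for print's averaging on the torus, LOCALLY, and [7] (3)–(4)–(6): the constraint space and the space (6) with body,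
# invariant under the group (4) — §4's `hinv` discharged for the concrete torus space

T. Bałaban, *Ultraviolet stability of three-dimensional lattice pure gauge field theories*, Commun. Math. Phys. **102**, 255–275
(1985) [Balaban1985UV3] (cell paper B10; held `paper:balaban1985-cmp102-uv-stability-3d`, journal page = PDF page + 254; p. 273 =
[PDF 19] re-read 2026-08-25 on the text layer `p0019.txt` L13–16, p. 267 = [PDF 13] on `p0013.txt` L1–4, p. 266 = [PDF 12] on `p0012.txt`).
«[7]» = T. Bałaban, *The variational problem and background fields in renormalization group method for lattice gauge theories*,
Commun. Math. Phys. **102**, 277–309 (1985) [Balaban1985Variational] (cell paper B11; p. 278 = [PDF 2] read AS IMAGE on the render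
`b2b-balaban-ref1/pages/1985-cmp102-variational-background/…-p002-x2.png`, p. 279 = [PDF 3] on `p0003.txt`).  «[6]» = T. Bałaban,
*Spaces of regular gauge field configurations on a lattice and gauge fixing conditions*, Commun. Math. Phys. **99**, 75–102 (1985)
[Balaban1985RegularSpaces] ((1.7) p. 77 = the same conditions, typed on `ℤ^d` by the cell as `B8Ineq132.CondAt` / `InAk`; held
`paper:balaban1985-cmp99-regular-spaces-gauge-fixing`, p. 76 = [PDF 2] `p0002.txt` L27–39 ((1.1), (1.2)), p. 77 = [PDF 3] `p0003.txt` L12–14, L25–28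
((1.7)–(1.9)), L32–39 ((1.11) and the invariance sentences), re-read 2026-08-25 for v1.1 §6).  «[4]» = T. Bałaban, *Averaging operations
for lattice gauge theories*, Commun. Math. Phys. **98**, 17–51 (1985) [Balaban1985Averaging] (cell paper B7; held `paper:balaban1985-cmp98-averaging`,
p. 19 = [PDF 3] `p0003.txt` L13–16 ((11) «we demand that the averaging preserves gauge transformations … \overline{U^u} = (Ū)^u»), L23 («if we
choose u coinciding with v at points of the new lattice»), p. 24 = [PDF 8] `p0008.txt` L5–7 (the locality of (43) and «the property (11) is
satisfied»), re-read 2026-08-25 for v1.2 §7).  «…» = verbatim.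

HONEST FRAMING (mega-formalization `lit-balaban`, verbatim): statement-level skeleton of published theorems with citation tags; proofs
where landed; nothing here is a claim about the Yang–Mills mass gap.

## The printed text

[Balaban1985UV3] p. 273: «Let us take a plaquette p′ ⊂ Λ_j and such that |V_j(∂p′) − 1| ≥ g_jp(g_j). We have  Ū_k^j = V_j on Λ_j,  (67)
and the configuration U_k satisfies the following regularity condition on B^j(Λ_j).  |U_k(∂p) − 1| < O(1)g_jp(q_j)L^{−2j}. ⟦sic: p(g_j)⟧
(68)».  p. 266: «The configuration U_k is determined by the variational problem considered in [7]» (42); p. 267 l. 1–2: «The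
configuration U_k satisfies the following regularity condition on Ω_k: |U_k(∂p) − 1| < 2L²B₃g_{k−1}p(g_{k−1})η².»  [7] p. 278: «The space
U_k({Ω_j}, ε₀) of gauge field configuration on configurations on Ω₀ was defined in Sect. A of [6] by the conditions
|U(∂p) − 1| = |(∂U)(p) − 1| < ε₀L^{−2j} = ε₀η²(L^jη)^{−2}  for  p ∈ Ω_j,  j = 0, 1, …, k,   |(D*_U∂U)(b)| < ε₀L^{−2j}(L^jη)^{−1} = ε₀η²(L^jη)^{−3}
for b ∈ Ω_j,  (2)  where ε₀ > 0 … The space U_k({Ω_j}, ε₀) is gauge invariant»; p. 279 Theorem 1: «for an arbitrary configuration V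
satisfying (7) with ε₁ ≤ a₁ there exists a minimal orbit in the space  U_k({Ω_j}, B₃ε₁) ∩ 𝔅_k(𝔅_k, V). (8)  This orbit is a unique critical
orbit in the space (6) if B₃ε₁ ≤ ε₀ and ε₀ ≤ a₀.»

## Why this file exists (unit `lit-balaban-r07`, reader/typer and fold owner of B10; gen 58; row B10.Eq68 member, B10.Eq71 knit rider)

(68) is membership of `U_k` in the SCALE-`j` plaquette clause of [7]'s space (2)/(8) read on `B^j(Λ_j) ⊂ Ω_j`.  In the torus chain of Sect. D
(`B10Eq71TorusLocal`, `B10Eq69TorusPullback` — gens 56–57 of this unit) it is the per-plaquette HYPOTHESIS `h68` («|U_k(∂q) − 1| ≤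
C₁g_jp(g_j)L^{−2j}` for the fine plaquettes `q ⊂ Δ′_j(p′)`, all orientations»).  THIS FILE gives [7] (2) a body on the torus and derives
`h68` from it, assembles the chain with (67) := (42) (`B10Eq42TorusConstraint`, gen 58, landed p392596), and records — in the cell's abstract
vocabulary of `B10NestedMinimizer` — WHICH application of [7] Theorem 1 yields the printed scale-`j` constant:

* §1 **`Touches X q`** («p ∈ Ω_j» for a fine plaquette and a region of `T_η`: some corner of `q` in `X` — the cell's reading of [6] (1.7) =
  [7] (2), `B8Ineq132.CondAt`'s `PlaqTouches`), **`RegAt j X ε U`** — THE SCALE-`j` PLAQUETTE CLAUSE OF (2) WITH BODY: `|U(∂q) − 1| < εL^{−2j}`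
  for every fine plaquette `q` touching `X` —, **`InSpace2 k Ω ε₀ U`** (all clauses `j ≤ k`: the plaquette half of «U ∈ U_k({Ω_j}, ε₀)»),
  monotonicity in `ε` and in the region, and **`regAt_gaugeAct` / `inSpace2_gaugeAct`** — [7] p. 278 «The space U_k({Ω_j}, ε₀) is gauge
  invariant» PROVED for the plaquette clauses (`|U^u(∂q) − 1| = |U(∂q) − 1|`);
* §2 **`src_mem_of_mem_deltaAllT`** (for `Ω_j` a union of `L^j`-blocks and `p′ ⊂ Ω_j` — all four corners —, every fine plaquette of `Δ′_j(p′)` =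
  `B10Eq69TorusPullback.deltaAllT j p′` has its lower-left corner in `Ω_j`: its `j`-block is a corner block of `p′`; `B10Eq71TorusOverlap`'s
  `blockIter_eq_iff_cubeIdx` / `isBlockUnion_pow_omega` BY NAME) and **`h68_of_regAt`** — (68) ON `Δ′_j(p′)` FROM MEMBERSHIP IN THE
  SCALE-`j` CLAUSE: `RegAt j Ω_j ε U ⇒ ∀ q ∈ Δ′_j(p′), |U(∂q) − 1| < εL^{−2j}`; the generated-domain instance `h68_of_regAt_omega`
  (every `j ≤ m + K` with `L ∣ M₁`, the `j = 0` case through `isBlockUnion_omega_pow` — every region is a union of `1`-blocks);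
* §3 **`quarter_sum_le_wilsonAction_of_regAt`** (`G = U(N)`, `d = 3`) / `…_specialUnitaryGroup` (`SU(N)`): gen 57's
  `B10Eq69TorusPullback.quarter_sum_le_wilsonAction_concrete` («We get these small factors for all plaquettes in all large fields set P»
  against `(N/g_k²)A^η(U_k)`) with its hypothesis `h68` DISCHARGED from `∀ j ∈ J, RegAt j Ω_j (ε_j) U_k` and `ε_j ≤ C₁g_jp(g_j)` — the remaining
  per-plaquette inputs being (67) (kept in §3 as gen 57's hypothesis shape `h67`; discharged from (42) in §5) and the large-field condition;
* §4 THE HONEST TRANSPORT «(68) from [7] Theorem 1».  The single application of [7] Thm 1 that B10 makes for (42) — at level `k`, with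
  `ε₁ = ε₁^{(k)} = 2L²g_{k−1}p(g_{k−1})` (p. 267 l. 1–2, the `χ_k` threshold of (40)) — puts `U_k` in `U_k({Ω_i}, B₃ε₁^{(k)})`, whose scale-`j`
  clause is `|U_k(∂p) − 1| < 2L²B₃g_{k−1}p(g_{k−1})L^{−2j}`: the constant of scale `k`, NOT print's `O(1)g_jp(g_j)` (`g_i = g(L^iε)^{1/2}`
  increases with `i` and `g ↦ gp(g)` increases near `0`), and (70)–(71) need the scale-`j` constant (their printed errors `O(1)(g_jp(g_j))³`,
  `O(1)g_jp³(g_j)`).  What yields it is [7] Thm 1 AT LEVEL `j+1` for `U_k`'s OWN `(j+1)`-datum `(V₀, …, V_j; Ū_k^{j+1}↾Ω_{j+1}^{(j+1)})`: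
  **`mem_space8_of_crit_nested`** — in `B10NestedMinimizer`'s vocabulary (configurations `X`; `(j+1)`-data `Y` with datum map `C`; `k`-data
  `W = D ∘ C`, the `k`-datum being a function of the `(j+1)`-datum — one more averaging per level, [4]'s `Ū^{i+1} = \overline{Ū^i}`): IF `U_k` is
  critical on the level-`k` constraint manifold of its own `k`-datum (it is [7]'s minimal = critical configuration at level `k`), criticality
  RESTRICTS to the level-`(j+1)` fibre through `U_k` (a sub-manifold: `B10NestedMinimizer.CritRestricts` / the law `hlaw`), `U_k` lies in the
  level-`(j+1)` uniqueness region (6) (a priori: `B₃ε₁^{(k)} ≤ ε₀`, p. 279), its `(j+1)`-datum is admissible ((7) at level `j+1` with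
  `ε₁^{[j+1]} = O(L²g_jp(g_j))`: (40) for `V_i`, `i ≤ j`, and the p. 267 sentence / [4] Prop. 2 for `Ū_k^{j+1}`), the uniqueness clause of
  Thm 1 at level `j+1` holds, the level-`(j+1)` minimiser map satisfies `LevelMin` ((L1): its values lie in (8)_{j+1}), and (8) is gauge
  invariant — THEN **`U_k ∈ (8)_{j+1}` of its own `(j+1)`-datum** (`B10NestedMinimizer.rel_uk_datum_of_crit` + `LevelMin.mem` BY NAME + the
  invariance); **`regAt_of_crit_nested`** reads its scale-`j` plaquette clause: `RegAt j Ω_j (B₃ε₁^{[j+1]}) U_k` — (68) with the printed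
  constant.  Every [7] clause is a HYPOTHESIS (row B11.Thm1); the kernel content is the composition;
* §5 **THE ASSEMBLED TORUS CHAIN** `quarter_sum_le_actionEta_of_constraint42_regAt` (`U(N)`) / `…_specialUnitaryGroup` (`SU(N)`) /
  `quarter_sum_le_actionEta_of_levelMin_regAt` (from the cell's `LevelMin` package at level `k`): Sect. D's small factors of ALL large-field
  plaquettes against `(N/g_k²)A^η(U_k)` from **(42)** (`B10Eq42TorusConstraint.h67_of_constraint42` ⇒ (67)) and **membership of `U_k` in the
  scale clauses of (2)** (§2 ⇒ (68)), the large-field condition `|V_j(∂p′) − 1| ≥ g_jp(g_j)`, `g_k² = g_j²L^{k−j}` and «g_j sufficiently small» —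
  both per-plaquette hypotheses `h67`, `h68` of gens 56–57 DISCHARGED; what remains of [7] is the existence of `U_k` (Thm 1 = B11.Thm1) and §4's
  provenance of the membership.
* §6 (v1.1) **THE COVARIANT-DERIVATIVE CLAUSE OF (2) = [6] (1.9) «|(D*_U∂U)(b)| < ε₀L^{−2j}(L^jη)^{−1} for b ∈ Ω_j» WITH BODY ON THE
  TORUS**, for configurations with values in the units `𝔸ˣ` of the lineage's Banach algebra (`U(N)` through `B10Eq27TorusAxialLog.unitsField`):
  [6] (1.1) **`covDerivT`** (backward covariant derivative, `U(x, x − e_ν) = U(x − e_ν, x)⁻¹`, `R(U)X = UXU⁻¹` = `B7Eq78Linearization.conjR`),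
  the plaquette field **`plaqFT`** (`F_{μν}(x) = U(∂p_{μν}(x))`), [6] (1.2) **`covDivT`**; THE DICTIONARY **`covDiv_pull`**: `(D^{η*}_{V♯_y}∂V♯_y)_μ(z)
  = (D^{η*}_V∂V)_μ(y + z)` — (1.2) on `T_η` IS the cell's `B8Ineq132.covDiv` of the periodic pullback `B10Eq27TorusAxialLog.pull` —, whence
  [6] (1.11) **`covDivT_gaugeActT`** (`= R(u(x))·`) and the invariance of `‖(D^{η*}_U∂U)(b)‖` TRANSPORTED from the cell's `covDiv_gaugeAct`
  BY NAME; the `η`-bookkeeping `covDivT_eq_smul` / **`regDivAt_iff_unit`** (the clause with spacing `η` IS its `η = 1` form with threshold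
  `εL^{−3j}` — the analogue for (1.9) of the cell's `threshold_18` for (1.8)); the clauses **`RegDivAt j X ε η V`** («b ∈ Ω_j» = an end-point in
  `Ω_j`, `BTouches`, [6] p. 77) and **`RegPlaqAt`** (the plaquette clause in the `𝔸`-letters; `regPlaqAt_unitsField_iff`: = §1's `RegAt` for the
  cell's `U(N)`); **`InSpaceA k Ω ε₀ η V` = BOTH CLAUSES OF (2), `j ≤ k` = [7]'s `U_k({Ω_j}, ε₀)` IN FULL** and, for the cell's `U(N)`,
  **`InSpace`** with `inSpace_iff : InSpace ↔ InSpace2 ∧ (divergence clauses)` — v1's HONEST SCOPE (i) made precise, `InSpace.inSpace2` feeding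
  every theorem of §§2–5 (`hR8_of_inSpace` for §4, `quarter_sum_le_actionEta_of_constraint42_inSpace` for §5); **[7] p. 278 «The space
  U_k({Ω_j}, ε₀) is gauge invariant» PROVED FOR THE FULL SPACE** (`inSpaceA_gaugeActT_iff` for norm-one-unit-valued `u`, `inSpace_gaugeAct_iff`
  for `U(N)`); monotonicity in `ε`, in the region and IN THE LEVEL ([6] p. 77 «if these conditions hold for some j = l, then they hold for all
  j < l», the cell's `thr_mono` BY NAME) and [6] p. 77 «it is enough to assume that (1.7), (1.9) hold for p, b ∈ B^j(Λ_j)» with print's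
  `Λ_j = B10Eq42TorusConstraint.lam42 Ω k j` (`inSpaceA_of_lam42`, `inSpace2_of_lam42`); non-vacuity (`U ≡ 1`: `covDivT_one`, `inSpaceA_one`,
  `inSpace_one`); the `SU(N)` reading `inSpace2_of_inSpace_toUField`.
* §7 (v1.2) **[4] (11) «\overline{U^u} = (Ū)^u» FOR PRINT'S AVERAGING ON THE TORUS, LOCALLY, AND [7] (3)–(4)–(6)**: the cell's (11)
  (`B7AvgGaugeCovariance.avgIter_gaugeAct`, r2) holds under the GLOBAL regularity (52); §7.1 localises it to ONE bond under (52) on its two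
  blocks `B^j(c₋) ∪ B^j(c₊)` only — **`avgIter_gaugeAct_local`** — by the clamp device of `B7Prop1Local` (`clampCfg_gaugeAct`: `π^*(V^u) =
  (π^*V)^{u∘π}`, `pdev_clampCfg_le`, `avgIter_congr` = [4] p. 24 «Ū^k_c depends only on U_b, b ⊂ B^k(c₋) ∪ B^k(c₊)»); §7.2 transports it to
  print's averaging `avgT` (`B10Eq69TorusPullback`) under §1's scale-`j` plaquette clause on a block union `X` containing the bond
  (`transl_fine_mem_of_bondBox`, `pdevOn_pull_bond_le`): **`avgT_gaugeAct`** / `avgT_gaugeAct_of_regAt` — `\overline{(U^u)}^j_c = u(x(c₋)) Ū^j_c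
  u(x(c₊))⁻¹` with `x(c) = fine P j c` the base corner where (43) is anchored; §7.3 **[7] (4) `Trivial4 k Λ u`** («u(y) = 1 for y ∈ 𝔅_k»: `u = 1` at
  the anchor of every coarse point of `Λ_j`, `j ≤ k`; a group: `Trivial4.mul` / `.inv`) and **`constraint42_gaugeAct`** = [7] p. 278 «the space
  𝔅_k(𝔅_k, V) is invariant with respect to gauge transformations u satisfying (4)» for the (42) file's `Constraint42` (= (3)) and members of the
  plaquette half of `U_k({Ω_j}, ε)`, `Λ_j ⊆ Ω_j` block unions; §7.4 **(6) WITH BODY `InSpace6 := InSpace ∧ Constraint42`**, non-vacuity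
  `inSpace6_one`, **`inSpace6_gaugeAct` / `inSpace6_gaugeAct_iff`** = «This space … [is] invariant with respect to the gauge transformations (4)
  … the space (6) is a union of orbits of this group», and **`hinv_inSpace6`** = §4's hypothesis `hinv` («(8) is gauge invariant») DISCHARGED
  for the concrete torus space with `rel U U′ :⟺ U = (U′)^u`, `u` in (4).

DICTIONARY print ↦ Lean: «p ∈ Ω_j» (fine plaquette) ↦ `Touches (Ω j) q`; «|U(∂p) − 1| < ε₀L^{−2j}» ↦ `dist1 (plaqHol U q) < ε * ((L^j)⁻¹)^2`
(the form of `B8Ineq132.CondAt`); `U_k({Ω_j}, ε₀)` (plaquette half) ↦ `{U | InSpace2 k Ω ε₀ U}`; «B^j(Λ_j)» ∩ «Δ′» ↦ `deltaAllT j p′` for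
`p′ ∈ plaqsIn j (Ω j)`; gauge transformation ↦ `GaugeField.gaugeAct u`; the abstract letters of §4 as in `B10NestedMinimizer` §1.  §6:
«b ∈ Ω_j» ↦ `BTouches (Ω j) b`; `F_{μν}(x)` ↦ `plaqFT V μ ν x`; `(D^{η*}_{U,ν}F)(x)` ↦ `covDerivT η V ν F x`; `(D^{η*}_U∂U)(⟨x, x + e_μ⟩)` ↦
`covDivT η V μ x`; «|(D*_U∂U)(b)| < ε₀L^{−2j}(L^jη)^{−1}» ↦ `‖covDivT η V b.dir b.src‖ < ε * ((L^j)⁻¹)^2 * ((L^j) * η)⁻¹` (the letters of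
`B8Ineq132.CondAt`); `U_k({Ω_j}, ε₀)` (both clauses) ↦ `{V | InSpaceA k Ω ε₀ η V}`, for `U(N)` `{U | InSpace k Ω ε₀ η U}`; `V♯_y` ↦ `pull V y`.  §7:
«u(y) = 1 for y ∈ 𝔅_k» (4) ↦ `Trivial4 k Λ u`; `𝔅_k(𝔅_k, V)` (3) ↦ `{U | Constraint42 k Λ V U}` (the (42) file); the space (6) ↦
`{U | InSpace6 k Ω Λ ε₀ η V U}`; `\overline{(U^u)}^j_c = u(L^jc₋) Ū^j_c u(L^jc₊)⁻¹` ((11)/(45) at a bond) ↦ `avgIter_gaugeAct_local` (`ℤ^d`),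
`avgT_gaugeAct` (torus, anchors `fine P j c`).

HONEST SCOPE.  (i) §§1–5 use only the PLAQUETTE clause of (2) (the covariant-derivative clause is not needed for (68)); `InSpace2` is
a SUPERSET of [7]'s `U_k({Ω_j}, ε₀)` — as a hypothesis, weaker —; v1.1 §6 types the covariant-derivative clause and the full space
(`InSpaceA`, `InSpace`) for `𝔸ˣ`-valued (hence `U(N)`-, `SU(N)`-valued) configurations, in which the ambient algebra of (1.1)/(1.2) makes sense
(an abstract `GaugeGroup` carries no `R(U)F − F`); the `η` of (1.1) is a parameter (print: `η = L^{−k}`·unit; it cancels against the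
threshold, `regDivAt_iff_unit`); [6] (1.10) (the `Re tr` form) and the locality of (1.2) (the cell's `covDiv_congr`) are not re-derived.  (ii) «p ∈ Ω_j»
— (i′) §7: (11) for `avgT` and the invariance of (3)/(6) are proved for `U(N)`-valued configurations in the scale-`j` plaquette clause on a
union of `L^j`-blocks containing the constraint bonds, under [4] Prop. 2's smallness `C₀ε₀ ≤ ⅓`, `2ε₀ ≤ c₂′(d, L)` WITH ROOM (`ε < ε₀`: the
clause is strict plaquette by plaquette, the cell's (52) is a strict bound on a supremum) — print states the invariances for the regular
configurations of (2) without displaying the smallness, which is that of [4] Prop. 2 used throughout [7]; (4) is read at the ANCHORS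
`fine P j c` (base corners, where (43) sees `u`, DIVERGENCE F3 of `Setup`) of the coarse points `c` with `toFine j c ∈ Λ_j`; the invariance
of the action (5) is not re-derived (`Setup.GaugeInvariant` bookkeeping of the cell). —
is read «p touches Ω_j» as in the cell's `ℤ^d` typing `B8Ineq132.CondAt`; for the block-union regions of B10 and the plaquettes of `Δ′_j(p′)`,
`p′ ⊂ Ω_j`, every reading gives (68) (`src_mem_of_mem_deltaAllT` puts the lower-left corner inside).  (iii) §4 asserts nothing of [7]: the
restriction law, the uniqueness clause, (L1) at level `j+1`, the a-priori membership in (6) and the admissibility of `Ū_k^{j+1}` are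
hypotheses — the last one is the p. 267 / [4] Prop. 2 input at each scale (on `Ω_k^{(j+1)}` it is gen 57's `B10Eq69TorusPullback.reg44_avg_torus`
from the level-`k` regularity; on `Ω_{j+1}∖Ω_k` it is this very transport one scale up — the downward induction in `j` is left to the
consumer).  (iv) `G = U(N)` in §3 (`SU(N)` through `B10Eq27TorusAxialLog.toUField`); §§1–2 for any `GaugeGroup`.  (v) Nothing of
[Balaban1985UV3], [7], [6] beyond the quoted sentences is asserted; `B10Eq69TorusPullback`, `B10Eq71TorusOverlap`, `B10Eq38TorusDomains`,
`B10NestedMinimizer` are used BY NAME.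

WHAT THIS FILE PROVES (kernel, no `sorry`, no named facts, no structures; definitions with bodies `Touches`, `RegAt`, `InSpace2` and (v1.1 §6)
`BTouches`, `plaqFT`, `covDerivT`, `covDivT`, `RegDivAt`, `RegPlaqAt`, `InSpaceA`, `InSpace`, and (v1.2 §7) `Trivial4`, `InSpace6`; theorems otherwise;
axioms standard).  Value = row B10.Eq68 gains a body on the carrier of record, the torus chain (67)–(71) loses its last
per-plaquette regularity hypothesis to a membership statement whose provenance in [7] is made precise, and Sect. D's small-factor bound is
assembled from (42) + (2) + the large-field condition + couplings in one theorem; v1.1: [7]'s regular space (2) is typed IN FULL on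
the torus with its gauge invariance proved and its covariant divergence identified with the cell's `ℤ^d` object; v1.2: [4] (11) holds for
print's averaging on the torus under LOCAL regularity and [7]'s spaces (3)/(6) are typed with their invariance under the group (4) proved,
discharging §4's `hinv`; NOT summit progress.
-/

noncomputable section

open scoped BigOperators

namespace Literature.MathematicalPhysics.QuantumFieldTheory.Balaban1983to89.B10Eq68TorusRegularity

open B7Prop1Explicit (plaqWord)
open B7Prop2Explicit (C0 c2')
open B10Eq27TorusAxialLog (holT toUField)
open B10Eq38TorusDomains (toFine cornerSet plaqsIn mem_plaqsIn_iff IsBlockUnion eq_of_cubeIdx_one_eq)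
open B10Eq69TorusPullback (avgT deltaAllT mem_deltaAllT_iff quarter_sum_le_wilsonAction_concrete
  quarter_sum_le_wilsonAction_concrete_specialUnitaryGroup)
open B10Eq71TorusOverlap (cornersJ toFine_mem_cornerSet blockIter_eq_iff_cubeIdx isBlockUnion_pow_omega)
open B10NestedMinimizer (LevelMin rel_uk_datum_of_crit)
open B14.Eq22Determines (blockIter)

variable {P : Params}

/-! ## §1 The plaquette clause of [7] (2) on the torus, with a body; gauge invariance -/

section Space2

variable {G : Type*} [GaugeGroup G]

/-- **«p ∈ Ω_j»** for a fine plaquette `q = ⟨x; μ, ν⟩` of `T_η` and a region `X ⊂ T_η`: some corner of `q` lies in `X` — the reading of the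
cell's `ℤ^d` typing of [6] (1.7) = [7] (2) (`B8Ineq132.CondAt`: `PlaqTouches`). [cite: Balaban1985Variational, (2) p.278; Balaban1985RegularSpaces, (1.7) p.77] -/
def Touches (X : Set (Site P 0)) (q : Plaq P 0) : Prop :=
  q.src ∈ X ∨ q.src.shift q.μ ∈ X ∨ q.src.shift q.ν ∈ X ∨ (q.src.shift q.μ).shift q.ν ∈ X

/-- A plaquette whose lower-left corner lies in `X` touches `X`. [cite: Balaban1985Variational, (2) p.278] -/
theorem touches_of_src_mem {X : Set (Site P 0)} {q : Plaq P 0} (h : q.src ∈ X) : Touches X q := Or.inl h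

/-- `Touches` is monotone in the region. [cite: Balaban1985Variational, (2) p.278] -/
theorem Touches.mono {X Y : Set (Site P 0)} (hXY : X ⊆ Y) {q : Plaq P 0} (h : Touches X q) : Touches Y q := by
  rcases h with h | h | h | h
  · exact Or.inl (hXY h)
  · exact Or.inr (Or.inl (hXY h))
  · exact Or.inr (Or.inr (Or.inl (hXY h)))
  · exact Or.inr (Or.inr (Or.inr (hXY h)))

/-- **THE SCALE-`j` PLAQUETTE CLAUSE OF [7] (2) WITH BODY ON THE TORUS**: «|U(∂p) − 1| < ε₀L^{−2j} for p ∈ Ω_j» — for every fine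
plaquette `q` of `T_η` touching the region `X` (print: `X = Ω_j`), `dist1 (U(∂q)) < ε·(L^j)⁻²` (the form `α·((L^j)⁻¹)²` of the cell's
`B8Ineq132.CondAt`; B10's (68) is this clause on `B^j(Λ_j) ⊂ Ω_j` with `ε = O(1)g_jp(g_j)`). [cite: Balaban1985Variational, (2) p.278; Balaban1985UV3, (68) p.273; Balaban1985RegularSpaces, (1.7) p.77] -/
def RegAt (j : ℕ) (X : Set (Site P 0)) (ε : ℝ) (U : GaugeField P 0 G) : Prop :=
  ∀ q : Plaq P 0, Touches X q → dist1 (GaugeField.plaqHol U q) < ε * (((P.L : ℝ) ^ j)⁻¹) ^ 2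

/-- **`U ∈ U_k({Ω_j}, ε₀)`, PLAQUETTE HALF**: the clauses of (2) for all `j ≤ k` («for p ∈ Ω_j, j = 0, 1, …, k»); the covariant-derivative
clause of (2) is not typed (HONEST SCOPE (i)). [cite: Balaban1985Variational, (2) p.278, (8) p.279] -/
def InSpace2 (k : ℕ) (Ω : ℕ → Set (Site P 0)) (ε₀ : ℝ) (U : GaugeField P 0 G) : Prop :=
  ∀ j, j ≤ k → RegAt j (Ω j) ε₀ U

/-- Unfolding `RegAt` at one plaquette. [cite: Balaban1985Variational, (2) p.278] -/
theorem RegAt.lt {j : ℕ} {X : Set (Site P 0)} {ε : ℝ} {U : GaugeField P 0 G} (h : RegAt j X ε U) {q : Plaq P 0}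
    (hq : Touches X q) : dist1 (GaugeField.plaqHol U q) < ε * (((P.L : ℝ) ^ j)⁻¹) ^ 2 :=
  h q hq

/-- The scale-`j` clause of a member of `U_k({Ω_j}, ε₀)`. [cite: Balaban1985Variational, (2) p.278] -/
theorem InSpace2.regAt {k : ℕ} {Ω : ℕ → Set (Site P 0)} {ε₀ : ℝ} {U : GaugeField P 0 G} (h : InSpace2 k Ω ε₀ U) {j : ℕ}
    (hj : j ≤ k) : RegAt j (Ω j) ε₀ U :=
  h j hj

/-- `RegAt` is monotone in the constant («ε₀ > 0» free). [cite: Balaban1985Variational, (2) p.278] -/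
theorem RegAt.mono_eps {j : ℕ} {X : Set (Site P 0)} {ε ε' : ℝ} (hε : ε ≤ ε') {U : GaugeField P 0 G} (h : RegAt j X ε U) :
    RegAt j X ε' U :=
  fun q hq => lt_of_lt_of_le (h q hq) (mul_le_mul_of_nonneg_right hε (sq_nonneg _))

/-- `RegAt` is monotone under shrinking the region. [cite: Balaban1985Variational, (2) p.278] -/
theorem RegAt.of_subset {j : ℕ} {X Y : Set (Site P 0)} (hXY : X ⊆ Y) {ε : ℝ} {U : GaugeField P 0 G} (h : RegAt j Y ε U) :
    RegAt j X ε U :=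
  fun q hq => h q (hq.mono hXY)

/-- Fewer levels: `U_k({Ω_j}, ε₀) ⊆ U_{k′}({Ω_j}_{j≤k′}, ε₀)` for `k′ ≤ k`. [cite: Balaban1985Variational, (2) p.278] -/
theorem InSpace2.mono_levels {k k' : ℕ} (hk : k' ≤ k) {Ω : ℕ → Set (Site P 0)} {ε₀ : ℝ} {U : GaugeField P 0 G}
    (h : InSpace2 k Ω ε₀ U) : InSpace2 k' Ω ε₀ U :=
  fun j hj => h j (hj.trans hk)

/-- Larger constant: `U_k({Ω_j}, ε₀) ⊆ U_k({Ω_j}, ε₀′)` for `ε₀ ≤ ε₀′` (e.g. (8) ⊆ (6) when `B₃ε₁ ≤ ε₀`, p. 279).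
[cite: Balaban1985Variational, (2) p.278, Thm 1 p.279] -/
theorem InSpace2.mono_eps {k : ℕ} {Ω : ℕ → Set (Site P 0)} {ε₀ ε₀' : ℝ} (hε : ε₀ ≤ ε₀') {U : GaugeField P 0 G}
    (h : InSpace2 k Ω ε₀ U) : InSpace2 k Ω ε₀' U :=
  fun j hj => (h j hj).mono_eps hε

/-- **NON-VACUITY**: the trivial configuration satisfies every clause with any `ε > 0`. [cite: Balaban1985Variational, (2) p.278] -/
theorem regAt_one (j : ℕ) (X : Set (Site P 0)) {ε : ℝ} (hε : 0 < ε) : RegAt j X ε (1 : GaugeField P 0 G) := by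
  intro q _
  have h1 : GaugeField.plaqHol (1 : GaugeField P 0 G) q = 1 := by
    simp [GaugeField.plaqHol, show ∀ b : PBond P 0, (1 : GaugeField P 0 G) b = 1 from fun _ => rfl]
  rw [h1, GaugeGroup.dist1_one]
  have hL : (0 : ℝ) < (P.L : ℝ) ^ j := by have := P.L_pos; positivity
  positivity

/-- **[7] p. 278 «The space U_k({Ω_j}, ε₀) is gauge invariant»** — PROVED for the scale-`j` plaquette clause: `U^u(∂q) =
u(q₋)U(∂q)u(q₋)⁻¹` ([4] (8)–(9)) and `|·|` is conjugation invariant (`GaugeGroup.dist1_conj`). [cite: Balaban1985Variational, p.278 (sentence after (3)); Balaban1985Averaging, (8)–(9) p.19] -/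
theorem regAt_gaugeAct {j : ℕ} {X : Set (Site P 0)} {ε : ℝ} {U : GaugeField P 0 G} (h : RegAt j X ε U)
    (u : GaugeTransf P 0 G) : RegAt j X ε (GaugeField.gaugeAct u U) := by
  intro q hq
  have hconj : GaugeField.plaqHol (GaugeField.gaugeAct u U) q = u q.src * GaugeField.plaqHol U q * (u q.src)⁻¹ := by
    simp only [GaugeField.plaqHol, GaugeField.gaugeAct, PBond.tgt, Site.shift_comm q.src q.ν q.μ, mul_inv_rev, inv_inv]
    group
  rw [hconj, GaugeGroup.dist1_conj]
  exact h q hq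

/-- The plaquette half of `U_k({Ω_j}, ε₀)` is gauge invariant. [cite: Balaban1985Variational, p.278 (sentence after (3))] -/
theorem inSpace2_gaugeAct {k : ℕ} {Ω : ℕ → Set (Site P 0)} {ε₀ : ℝ} {U : GaugeField P 0 G} (h : InSpace2 k Ω ε₀ U)
    (u : GaugeTransf P 0 G) : InSpace2 k Ω ε₀ (GaugeField.gaugeAct u U) :=
  fun j hj => regAt_gaugeAct (h j hj) u

end Space2

/-! ## §2 (68) on `Δ′_j(p′)` from membership in the scale-`j` clause -/

section Eq68

variable {G : Type*} [GaugeGroup G]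

/-- **EVERY FINE PLAQUETTE OF `Δ′_j(p′)` HAS ITS CORNER IN `Ω_j`** (print: (68) «on B^j(Λ_j)», `Δ′ ⊂ B^j(Λ_j) ⊂ Ω_j` for `p′ ⊂ Λ_j ⊂ Ω_j^{(j)}`):
if `Ω_j` is a union of `L^j`-blocks and all four corners of `p′ ∈ T^{(j)}` lie in `Ω_j` (`p′ ∈ plaqsIn j Ω_j`), then for `q ∈ deltaAllT j p′` the
`j`-block of `q₋` is a corner block of `p′`, whose centre lies in `Ω_j`, hence so does `q₋` (standing range `j ≤ m + K`).
[cite: Balaban1985UV3, (68) p.273, (39) p.266] -/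
theorem src_mem_of_mem_deltaAllT {j : ℕ} (hj : j ≤ P.m + P.K) {Ωj : Set (Site P 0)} (hΩ : IsBlockUnion (P.L ^ j) Ωj)
    {p : Plaq P j} (hp : p ∈ plaqsIn j Ωj) {q : Plaq P 0} (hq : q ∈ deltaAllT j p) : q.src ∈ Ωj := by
  obtain ⟨hc, -⟩ := mem_deltaAllT_iff.mp hq
  set c : Site P j := blockIter j q.src with hcdef
  have hcube := (blockIter_eq_iff_cubeIdx hj q.src c).mp rfl
  have hcorner : toFine j c ∈ Ωj := (mem_plaqsIn_iff.mp hp) (toFine_mem_cornerSet hc)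
  exact (hΩ hcube).mpr hcorner

/-- **(68) ON `Δ′_j(p′)` FROM THE SCALE-`j` CLAUSE OF (2)**: if `U` satisfies «|U(∂q) − 1| < εL^{−2j} for q ∈ Ω_j» (`RegAt j Ω_j ε U`), `Ω_j` is a
union of `L^j`-blocks and `p′ ⊂ Ω_j`, then `|U(∂q) − 1| < ε(L^j)⁻²` for every fine plaquette `q` of `Δ′_j(p′)` (all orientations) — the
hypothesis `h68` of `B10Eq69TorusPullback.smallFactor_of_largeField_torus_concrete` with `O(1)g_jp(g_j) := ε`.
[cite: Balaban1985UV3, (68) p.273; Balaban1985Variational, (2) p.278] -/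
theorem h68_of_regAt {j : ℕ} (hj : j ≤ P.m + P.K) {Ωj : Set (Site P 0)} (hΩ : IsBlockUnion (P.L ^ j) Ωj) {ε : ℝ}
    {U : GaugeField P 0 G} (hU : RegAt j Ωj ε U) {p : Plaq P j} (hp : p ∈ plaqsIn j Ωj) :
    ∀ q ∈ deltaAllT j p, dist1 (GaugeField.plaqHol U q) < ε * (((P.L : ℝ) ^ j)⁻¹) ^ 2 :=
  fun _ hq => hU _ (touches_of_src_mem (src_mem_of_mem_deltaAllT hj hΩ hp hq))

/-- The non-strict form with the constant written as in gen 57's `h68` (`C₁g_jp_j / (L^j)²`), from `ε ≤ C₁g_jp_j`.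
[cite: Balaban1985UV3, (68) p.273] -/
theorem h68_le_of_regAt {j : ℕ} (hj : j ≤ P.m + P.K) {Ωj : Set (Site P 0)} (hΩ : IsBlockUnion (P.L ^ j) Ωj) {ε c : ℝ}
    (hεc : ε ≤ c) {U : GaugeField P 0 G} (hU : RegAt j Ωj ε U) {p : Plaq P j} (hp : p ∈ plaqsIn j Ωj) :
    ∀ q ∈ deltaAllT j p, dist1 (GaugeField.plaqHol U q) ≤ c / ((P.L : ℝ) ^ j) ^ 2 := by
  intro q hq
  have h := h68_of_regAt hj hΩ (hU.mono_eps hεc) hp q hq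
  rw [inv_pow, ← div_eq_mul_inv] at h
  exact h.le

variable (M₁ : ℕ) (R : ℕ → ℝ) (Ω₀ : Set (Site P 0)) (S : (j : ℕ) → Finset (Plaq P j))

/-- **The generated domains are block unions at every scale**: `Ω_j` (`B10Eq71TorusOverlap.Ω`, the p. 268 rule from the large-field sets) is a
union of `L^j`-blocks for `j ≥ 1` when `L ∣ M₁` (`isBlockUnion_pow_omega`), and every region is a union of `L^0 = 1`-blocks.
[cite: Balaban1985UV3, (39) p.266, p.268] -/
theorem isBlockUnion_omega_pow (hdiv : P.L ∣ M₁) (j : ℕ) : IsBlockUnion (P.L ^ j) (B10Eq71TorusOverlap.Ω M₁ R Ω₀ S j) := by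
  rcases Nat.eq_zero_or_pos j with rfl | hj
  · intro x y hxy
    rw [pow_zero] at hxy
    rw [eq_of_cubeIdx_one_eq hxy]
  · exact isBlockUnion_pow_omega M₁ R Ω₀ S hj hdiv

/-- **(68) for the large-field plaquettes of the generated domains**: `S j ⊆ plaqsIn j Ω_j` (the decomposition (7) made «on the domain»,
p. 267), `L ∣ M₁`, `j ≤ m + K`, `U` in the scale-`j` clause with constant `ε ≤ C₁g_jp_j` ⇒ `h68` on `Δ′_j(p′)` for every `p′ ∈ S j`.
[cite: Balaban1985UV3, (68) p.273, p.267, p.268] -/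
theorem h68_of_regAt_omega (hdiv : P.L ∣ M₁) {j : ℕ} (hj : j ≤ P.m + P.K)
    (hS : S j ⊆ plaqsIn j (B10Eq71TorusOverlap.Ω M₁ R Ω₀ S j)) {ε c : ℝ} (hεc : ε ≤ c) {U : GaugeField P 0 G}
    (hU : RegAt j (B10Eq71TorusOverlap.Ω M₁ R Ω₀ S j) ε U) :
    ∀ p ∈ S j, ∀ q ∈ deltaAllT j p, dist1 (GaugeField.plaqHol U q) ≤ c / ((P.L : ℝ) ^ j) ^ 2 :=
  fun _ hp => h68_le_of_regAt hj (isBlockUnion_omega_pow M₁ R Ω₀ S hdiv j) hεc hU (hS hp)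

end Eq68

/-! ## §3 The knit: Sect. D's small factors with (68) discharged from the scale clauses of (2) -/

section Knit

open scoped Matrix.Norms.L2Operator

variable (M₁ : ℕ) (R : ℕ → ℝ) (Ω₀ : Set (Site P 0)) (S : (j : ℕ) → Finset (Plaq P j))
variable {N : ℕ} [NeZero N]

/-- **THE SMALL FACTORS OF ALL LARGE-FIELD PLAQUETTES AGAINST THE FULL ACTION WITH (68) := MEMBERSHIP IN THE SCALE CLAUSES OF (2)**
(`G = U(N)`, `d = 3`): in the setting of `B10Eq69TorusPullback.quarter_sum_le_wilsonAction_concrete` (domains generated by the p. 268 rule from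
the large-field sets `S`, `R(g_i)M₁ ≥ 0`, `L ∣ M₁`, levels `j ∈ J`, `j ≤ m + K`, `j ≤ k`, the history's plaquettes `S′ j ⊆ S j ⊆ plaqsIn j Ω_j`),
suppose `U = U_k` satisfies, for every `j ∈ J`, the scale-`j` plaquette clause of [7] (2) on `Ω_j` with a constant `ε_j ≤ C₁g_jp(g_j)` (print's
(68) «|U_k(∂p) − 1| < O(1)g_jp(g_j)L^{−2j}»); then with (67), the large-field condition, `g_k² = g_j²L^{k−j}` and «g_j sufficiently small» (as
in gen 57): **`¼·Σ_{j∈J} Σ_{p′∈S′ j} ¼p_j² ≤ (N/g_k²)·A^η(U_k)`**, `A^η(U_k) = wilsonAction (L^k) U`. [cite: Balaban1985UV3, (67)–(71) p.273, (41) p.266, (5) p.256; Balaban1985Variational, (2) p.278] -/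
theorem quarter_sum_le_wilsonAction_of_regAt (hd : P.d = 3) (hR : ∀ i, 0 ≤ R i * M₁) (hdiv : P.L ∣ M₁)
    (J : Finset ℕ) (hJ : ∀ j ∈ J, j ≤ P.m + P.K) {k : ℕ} (hJk : ∀ j ∈ J, j ≤ k) (S' : (j : ℕ) → Finset (Plaq P j))
    (hS' : ∀ j ∈ J, S' j ⊆ S j)
    (hS : ∀ j ∈ J, S j ⊆ plaqsIn j (B10Eq71TorusOverlap.Ω M₁ R Ω₀ S j))
    (U : GaugeField P 0 (Matrix.unitaryGroup (Fin N) ℂ)) (V : (j : ℕ) → GaugeField P j (Matrix.unitaryGroup (Fin N) ℂ))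
    (g : ℕ → ℝ) (pj : ℕ → ℝ) (ε : ℕ → ℝ) {gk C₁ : ℝ} (hC₁ : 0 < C₁)
    (hgj : ∀ j ∈ J, 0 < g j) (hgk : ∀ j ∈ J, gk ^ 2 = g j ^ 2 * (P.L : ℝ) ^ (k - j)) (hp : ∀ j ∈ J, 0 < pj j)
    (hgp : ∀ j ∈ J, g j * pj j ≤ 1)
    (h67 : ∀ j ∈ J, ∀ p' ∈ S' j,
      ((holT (avgT j U) p'.src (plaqWord p'.μ p'.ν) : (Matrix (Fin N) (Fin N) ℂ)ˣ) : Matrix (Fin N) (Fin N) ℂ) =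
        ((GaugeField.plaqHol (V j) p' : Matrix.unitaryGroup (Fin N) ℂ) : Matrix (Fin N) (Fin N) ℂ))
    (hLF : ∀ j ∈ J, ∀ p' ∈ S' j, g j * pj j ≤ dist1 (GaugeField.plaqHol (V j) p'))
    (h2 : ∀ j ∈ J, RegAt j (B10Eq71TorusOverlap.Ω M₁ R Ω₀ S j) (ε j) U)
    (hε : ∀ j ∈ J, ε j ≤ C₁ * (g j * pj j))
    (hα3 : ∀ j ∈ J, C0 3 * (2 * C₁ * (g j * pj j)) ≤ 1 / 3) (hα2 : ∀ j ∈ J, 2 * (2 * C₁ * (g j * pj j)) ≤ c2' 3 P.L)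
    (hsmall : ∀ j ∈ J, (2 * C₁ * (64 / 3 * C0 3 * C₁ ^ 2) + (64 / 3 * C0 3 * C₁ ^ 2) ^ 2) / 2 * g j * pj j ≤ 1 / 4) :
    (1 / 4 : ℝ) * ∑ j ∈ J, ∑ _p' ∈ S' j, pj j ^ 2 / 4 ≤
      ((gk ^ 2)⁻¹ * (N : ℝ)) * wilsonAction ((P.L : ℝ) ^ k) U :=
  quarter_sum_le_wilsonAction_concrete M₁ R Ω₀ S hd hR hdiv J hJ hJk S' hS' hS U V g pj hC₁ hgj hgk hp hgp h67 hLF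
    (fun j hj p' hp' => h68_of_regAt_omega M₁ R Ω₀ S hdiv (hJ j hj) (hS j hj) (hε j hj) (h2 j hj) p' (hS' j hj hp'))
    hα3 hα2 hsmall

/-- The same for the semi-simple group `G = SU(N)` of Theorem 1 (the clauses of (2) for the `SU(N)`-valued `U`; `dist1` agrees through
`toUField`). [cite: Balaban1985UV3, (67)–(71) p.273, Thm 1 p.257; Balaban1985Variational, (2) p.278] -/
theorem quarter_sum_le_wilsonAction_of_regAt_specialUnitaryGroup (hd : P.d = 3) (hR : ∀ i, 0 ≤ R i * M₁)
    (hdiv : P.L ∣ M₁) (J : Finset ℕ) (hJ : ∀ j ∈ J, j ≤ P.m + P.K) {k : ℕ} (hJk : ∀ j ∈ J, j ≤ k)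
    (S' : (j : ℕ) → Finset (Plaq P j)) (hS' : ∀ j ∈ J, S' j ⊆ S j)
    (hS : ∀ j ∈ J, S j ⊆ plaqsIn j (B10Eq71TorusOverlap.Ω M₁ R Ω₀ S j))
    (U : GaugeField P 0 (Matrix.specialUnitaryGroup (Fin N) ℂ))
    (V : (j : ℕ) → GaugeField P j (Matrix.specialUnitaryGroup (Fin N) ℂ))
    (g : ℕ → ℝ) (pj : ℕ → ℝ) (ε : ℕ → ℝ) {gk C₁ : ℝ} (hC₁ : 0 < C₁)
    (hgj : ∀ j ∈ J, 0 < g j) (hgk : ∀ j ∈ J, gk ^ 2 = g j ^ 2 * (P.L : ℝ) ^ (k - j)) (hp : ∀ j ∈ J, 0 < pj j)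
    (hgp : ∀ j ∈ J, g j * pj j ≤ 1)
    (h67 : ∀ j ∈ J, ∀ p' ∈ S' j,
      ((holT (avgT j (toUField U)) p'.src (plaqWord p'.μ p'.ν) : (Matrix (Fin N) (Fin N) ℂ)ˣ) : Matrix (Fin N) (Fin N) ℂ) =
        ((GaugeField.plaqHol (V j) p' : Matrix.specialUnitaryGroup (Fin N) ℂ) : Matrix (Fin N) (Fin N) ℂ))
    (hLF : ∀ j ∈ J, ∀ p' ∈ S' j, g j * pj j ≤ dist1 (GaugeField.plaqHol (V j) p'))
    (h2 : ∀ j ∈ J, RegAt j (B10Eq71TorusOverlap.Ω M₁ R Ω₀ S j) (ε j) U)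
    (hε : ∀ j ∈ J, ε j ≤ C₁ * (g j * pj j))
    (hα3 : ∀ j ∈ J, C0 3 * (2 * C₁ * (g j * pj j)) ≤ 1 / 3) (hα2 : ∀ j ∈ J, 2 * (2 * C₁ * (g j * pj j)) ≤ c2' 3 P.L)
    (hsmall : ∀ j ∈ J, (2 * C₁ * (64 / 3 * C0 3 * C₁ ^ 2) + (64 / 3 * C0 3 * C₁ ^ 2) ^ 2) / 2 * g j * pj j ≤ 1 / 4) :
    (1 / 4 : ℝ) * ∑ j ∈ J, ∑ _p' ∈ S' j, pj j ^ 2 / 4 ≤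
      ((gk ^ 2)⁻¹ * (N : ℝ)) * wilsonAction ((P.L : ℝ) ^ k) U :=
  quarter_sum_le_wilsonAction_concrete_specialUnitaryGroup M₁ R Ω₀ S hd hR hdiv J hJ hJk S' hS' hS U V g pj hC₁ hgj hgk hp
    hgp h67 hLF
    (fun j hj p' hp' => h68_of_regAt_omega M₁ R Ω₀ S hdiv (hJ j hj) (hS j hj) (hε j hj) (h2 j hj) p' (hS' j hj hp'))
    hα3 hα2 hsmall

end Knit

/-! ## §4 The honest transport: (68) is [7] Theorem 1 AT LEVEL `j+1` for `U_k`'s own `(j+1)`-datum -/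

section Transport

variable {X Y W : Type*}

/-- **`U_k` LIES IN THE SPACE (8) OF LEVEL `j+1` OF ITS OWN `(j+1)`-DATUM.**  Letters (the cell's `B10NestedMinimizer` §1): `X` =
configurations on `T_η`; `Y` = `(j+1)`-data with datum map `C : X → Y` (`U ↦ ((Ū^i↾Λ_i)_{i≤j}, Ū^{j+1}↾Ω_{j+1}^{(j+1)})`); `W` = `k`-data,
`D : Y → W` the coarsening (the `k`-datum is a function of the `(j+1)`-datum: one more block average per level, [4] «Ū^{i+1} = \overline{Ū^i}»,
so that `D ∘ C` is the level-`k` datum map and the `(j+1)`-fibre through `x` lies in its `k`-fibre); `Uj : Y → X` the level-`(j+1)` minimiser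
map with its package `LevelMin F C R8 T Uj` ((L1) = [7] Thm 1 at level `j+1`: `Uj y ∈ R8 y` = the space (8)); `CritJ` / `CritK` = «critical
configuration of (5) on the constraint manifold» at the two levels, linked by the RESTRICTION LAW `hlaw` (critical on the `k`-fibre through
`x` ⇒ critical on the `(j+1)`-fibre through `x`, its sub-manifold — `B10NestedMinimizer.CritRestricts`); `R6` = the level-`(j+1)` uniqueness
region (6); `huniq` = the uniqueness clause of [7] Thm 1 at level `j+1` («a unique critical orbit in the space (6)»); `rel` = «differ by a gauge
transformation of the group (4)», under which (8) is invariant (`hinv`: [7] p. 278 «The space U_k({Ω_j}, ε₀) is gauge invariant», and (3) is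
invariant under (4)).  THEN: if `U_k` is critical at level `k` on the fibre of its own `k`-datum (it is, being [7]'s minimal = critical
configuration of (42)), lies in (6)_{j+1} (a priori: `B₃ε₁^{(k)} ≤ ε₀`, p. 279) and has an ADMISSIBLE `(j+1)`-datum ((7) at level `j+1` — (40)
for `V_i`, `i ≤ j`; the p. 267 sentence / [4] Prop. 2 for `Ū_k^{j+1}`), it lies in **(8)_{j+1} of its own `(j+1)`-datum** — whose scale-`j`
plaquette clause is (68) WITH THE SCALE-`j` CONSTANT `B₃ε₁^{[j+1]} = O(L²g_jp(g_j))`, not the `2L²B₃g_{k−1}p(g_{k−1})` of the level-`k`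
application (p. 267 l. 1–2).  Proof: `B10NestedMinimizer.rel_uk_datum_of_crit` puts `U_k` on the orbit of `Uj (C U_k)`, which lies in (8)
(`LevelMin.mem`), and (8) is invariant.  Every clause is a hypothesis (row B11.Thm1); nothing of [7] is asserted.
[cite: Balaban1985UV3, (68) p.273, (42) p.266, p.267; Balaban1985Variational, Thm 1 (8) p.279, (2)–(6) p.278] -/
theorem mem_space8_of_crit_nested {F : X → ℝ} (C : X → Y) (D : Y → W) {R8 : Y → Set X} {T : Set Y} {Uj : Y → X}
    (hL : LevelMin F C R8 T Uj) (CritJ : Y → X → Prop) (CritK : W → X → Prop) (R6 : Set X) (rel : X → X → Prop)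
    (hlaw : ∀ x, CritK (D (C x)) x → CritJ (C x) x)
    (huniq : ∀ y ∈ T, ∀ x ∈ R6, C x = y → CritJ y x → rel x (Uj y))
    (hinv : ∀ (y : Y) (x x' : X), rel x x' → x' ∈ R8 y → x ∈ R8 y)
    {Uk : X} (hcrit : CritK (D (C Uk)) Uk) (hreg : Uk ∈ R6) (hadm : C Uk ∈ T) : Uk ∈ R8 (C Uk) :=
  hinv (C Uk) Uk (Uj (C Uk)) (rel_uk_datum_of_crit C D Uj CritJ CritK R6 T rel hlaw huniq hcrit hreg hadm)
    (hL.mem (C Uk) hadm)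

variable {G : Type*} [GaugeGroup G]

/-- **(68) WITH THE PRINTED SCALE-`j` CONSTANT, READ OFF THE TRANSPORT**: under the hypotheses of `mem_space8_of_crit_nested` for
configurations on the torus, if the level-`(j+1)` space (8) of every datum is contained in the plaquette half of `U_{j+1}({Ω_i}_{i≤j+1},
B₃ε₁^{[j+1]})` (the dictionary clause `hR8`), then `U_k` satisfies the scale-`j` clause «|U_k(∂q) − 1| < B₃ε₁^{[j+1]}L^{−2j} for q ∈ Ω_j» —
print's (68) with `O(1)g_jp(g_j) = B₃ε₁^{[j+1]}` — which §2–§3 consume. [cite: Balaban1985UV3, (68) p.273; Balaban1985Variational, Thm 1 (8) p.279, (2) p.278] -/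
theorem regAt_of_crit_nested {F : GaugeField P 0 G → ℝ} (C : GaugeField P 0 G → Y) (D : Y → W) {R8 : Y → Set (GaugeField P 0 G)}
    {T : Set Y} {Uj : Y → GaugeField P 0 G} (hL : LevelMin F C R8 T Uj) (CritJ : Y → GaugeField P 0 G → Prop)
    (CritK : W → GaugeField P 0 G → Prop) (R6 : Set (GaugeField P 0 G)) (rel : GaugeField P 0 G → GaugeField P 0 G → Prop)
    (hlaw : ∀ x, CritK (D (C x)) x → CritJ (C x) x)
    (huniq : ∀ y ∈ T, ∀ x ∈ R6, C x = y → CritJ y x → rel x (Uj y))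
    (hinv : ∀ (y : Y) (x x' : GaugeField P 0 G), rel x x' → x' ∈ R8 y → x ∈ R8 y)
    {j : ℕ} {Ω : ℕ → Set (Site P 0)} {ε : ℝ} (hR8 : ∀ y, R8 y ⊆ {U | InSpace2 (j + 1) Ω ε U})
    {Uk : GaugeField P 0 G} (hcrit : CritK (D (C Uk)) Uk) (hreg : Uk ∈ R6) (hadm : C Uk ∈ T) :
    RegAt j (Ω j) ε Uk :=
  (hR8 (C Uk) (mem_space8_of_crit_nested C D hL CritJ CritK R6 rel hlaw huniq hinv hcrit hreg hadm)).regAt (Nat.le_succ j)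

/-- **What the single level-`k` application gives instead** (p. 267 l. 1–2 read through (2)): a member of the plaquette half of
`U_k({Ω_i}, B₃ε₁^{(k)})` satisfies at scale `j ≤ k` only the clause with the level-`k` constant `B₃ε₁^{(k)}` — recorded as the contrast to
`regAt_of_crit_nested` (for `j < k` this constant, `2L²B₃g_{k−1}p(g_{k−1})`, exceeds print's `O(1)g_jp(g_j)`).
[cite: Balaban1985UV3, p.267 (l. 1–2), (68) p.273; Balaban1985Variational, (2) p.278, (8) p.279] -/
theorem regAt_of_inSpace2_levelK {k : ℕ} {Ω : ℕ → Set (Site P 0)} {ε₀ : ℝ} {U : GaugeField P 0 G} (h : InSpace2 k Ω ε₀ U)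
    {j : ℕ} (hj : j ≤ k) : RegAt j (Ω j) ε₀ U :=
  h.regAt hj

end Transport


/-! ## §5 THE ASSEMBLED TORUS CHAIN: (42) + the scale clauses of (2) + the large-field condition ⇒ the small factors -/

section Chain

open B10Eq42TorusConstraint (Constraint42 lam42 actionEta actionEta_eq h67_of_constraint42 mem_plaqsIn_lam42 KData datum ofData
  isMin42_of_levelMin)

variable (M₁ : ℕ) (R : ℕ → ℝ) (Ω₀ : Set (Site P 0)) (S : (j : ℕ) → Finset (Plaq P j))
variable {N : ℕ} [NeZero N]

/-- **SECT. D's SMALL FACTORS FROM (42) AND THE SCALE CLAUSES OF (2) ALONE** (`G = U(N)`, `d = 3`): in the setting of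
`B10Eq69TorusPullback.quarter_sum_le_wilsonAction_concrete` (domains generated by the p. 268 rule, `R(g_i)M₁ ≥ 0`, `L ∣ M₁`, levels `j ∈ J`,
`j ≤ m + K`, `j ≤ k`, the history's plaquettes `S′ j ⊆ S j ⊆ plaqsIn j Ω_j`), if `U = U_k` satisfies the constraint **(42)** for the data
`(V_j)` on `Λ = lam42 Ω k` (⇒ (67), `B10Eq42TorusConstraint.h67_of_constraint42`) and, for every `j ∈ J`, the scale-`j` plaquette clause of
[7] (2) on `Ω_j` with `ε_j ≤ C₁g_jp(g_j)` (⇒ (68), `h68_of_regAt`), then under the large-field condition, `g_k² = g_j²L^{k−j}` and «g_j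
sufficiently small»: **`¼·Σ_{j∈J} Σ_{p′∈S′ j} ¼p_j² ≤ (N/g_k²)·A^η(U_k)`** — BOTH per-plaquette hypotheses of gens 56–57 (`h67`, `h68`)
discharged. [cite: Balaban1985UV3, (67)–(71) p.273, (42) p.266, (41) p.266, (5) p.256; Balaban1985Variational, (2) p.278] -/
theorem quarter_sum_le_actionEta_of_constraint42_regAt (hd : P.d = 3) (hR : ∀ i, 0 ≤ R i * M₁) (hdiv : P.L ∣ M₁)
    (J : Finset ℕ) (hJ : ∀ j ∈ J, j ≤ P.m + P.K) {k : ℕ} (hJk : ∀ j ∈ J, j ≤ k) (S' : (j : ℕ) → Finset (Plaq P j))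
    (hS' : ∀ j ∈ J, S' j ⊆ S j)
    (hS : ∀ j ∈ J, S j ⊆ plaqsIn j (B10Eq71TorusOverlap.Ω M₁ R Ω₀ S j))
    (U : GaugeField P 0 (Matrix.unitaryGroup (Fin N) ℂ)) (V : (j : ℕ) → GaugeField P j (Matrix.unitaryGroup (Fin N) ℂ))
    (h42 : Constraint42 k (lam42 (B10Eq71TorusOverlap.Ω M₁ R Ω₀ S) k) V U)
    (g : ℕ → ℝ) (pj : ℕ → ℝ) (ε : ℕ → ℝ) {gk C₁ : ℝ} (hC₁ : 0 < C₁)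
    (hgj : ∀ j ∈ J, 0 < g j) (hgk : ∀ j ∈ J, gk ^ 2 = g j ^ 2 * (P.L : ℝ) ^ (k - j)) (hp : ∀ j ∈ J, 0 < pj j)
    (hgp : ∀ j ∈ J, g j * pj j ≤ 1)
    (hLF : ∀ j ∈ J, ∀ p' ∈ S' j, g j * pj j ≤ dist1 (GaugeField.plaqHol (V j) p'))
    (h2 : ∀ j ∈ J, RegAt j (B10Eq71TorusOverlap.Ω M₁ R Ω₀ S j) (ε j) U)
    (hε : ∀ j ∈ J, ε j ≤ C₁ * (g j * pj j))
    (hα3 : ∀ j ∈ J, C0 3 * (2 * C₁ * (g j * pj j)) ≤ 1 / 3) (hα2 : ∀ j ∈ J, 2 * (2 * C₁ * (g j * pj j)) ≤ c2' 3 P.L)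
    (hsmall : ∀ j ∈ J, (2 * C₁ * (64 / 3 * C0 3 * C₁ ^ 2) + (64 / 3 * C0 3 * C₁ ^ 2) ^ 2) / 2 * g j * pj j ≤ 1 / 4) :
    (1 / 4 : ℝ) * ∑ j ∈ J, ∑ _p' ∈ S' j, pj j ^ 2 / 4 ≤
      ((gk ^ 2)⁻¹ * (N : ℝ)) * actionEta k U := by
  have hS'Λ : ∀ j ∈ J, S' j ⊆ plaqsIn j (lam42 (B10Eq71TorusOverlap.Ω M₁ R Ω₀ S) k j) :=
    fun j hj p hp => mem_plaqsIn_lam42 M₁ R Ω₀ S hR (hJk j hj) (hS j hj) (hS' j hj hp)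
  rw [actionEta_eq]
  exact quarter_sum_le_wilsonAction_of_regAt M₁ R Ω₀ S hd hR hdiv J hJ hJk S' hS' hS U V g pj ε hC₁ hgj hgk hp hgp
    (h67_of_constraint42 h42 J hJk S' hS'Λ) hLF h2 hε hα3 hα2 hsmall

/-- The same for the semi-simple group `G = SU(N)` of Theorem 1: (42) for the `U(N)`-read configuration `toUField U` and data
`toUField ∘ V`, the clauses of (2) for the `SU(N)`-valued `U`. [cite: Balaban1985UV3, (67)–(71) p.273, (42) p.266, Thm 1 p.257; Balaban1985Variational, (2) p.278] -/
theorem quarter_sum_le_wilsonAction_of_constraint42_regAt_specialUnitaryGroup (hd : P.d = 3) (hR : ∀ i, 0 ≤ R i * M₁)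
    (hdiv : P.L ∣ M₁) (J : Finset ℕ) (hJ : ∀ j ∈ J, j ≤ P.m + P.K) {k : ℕ} (hJk : ∀ j ∈ J, j ≤ k)
    (S' : (j : ℕ) → Finset (Plaq P j)) (hS' : ∀ j ∈ J, S' j ⊆ S j)
    (hS : ∀ j ∈ J, S j ⊆ plaqsIn j (B10Eq71TorusOverlap.Ω M₁ R Ω₀ S j))
    (U : GaugeField P 0 (Matrix.specialUnitaryGroup (Fin N) ℂ))
    (V : (j : ℕ) → GaugeField P j (Matrix.specialUnitaryGroup (Fin N) ℂ))
    (h42 : Constraint42 k (lam42 (B10Eq71TorusOverlap.Ω M₁ R Ω₀ S) k) (fun j => toUField (V j)) (toUField U))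
    (g : ℕ → ℝ) (pj : ℕ → ℝ) (ε : ℕ → ℝ) {gk C₁ : ℝ} (hC₁ : 0 < C₁)
    (hgj : ∀ j ∈ J, 0 < g j) (hgk : ∀ j ∈ J, gk ^ 2 = g j ^ 2 * (P.L : ℝ) ^ (k - j)) (hp : ∀ j ∈ J, 0 < pj j)
    (hgp : ∀ j ∈ J, g j * pj j ≤ 1)
    (hLF : ∀ j ∈ J, ∀ p' ∈ S' j, g j * pj j ≤ dist1 (GaugeField.plaqHol (V j) p'))
    (h2 : ∀ j ∈ J, RegAt j (B10Eq71TorusOverlap.Ω M₁ R Ω₀ S j) (ε j) U)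
    (hε : ∀ j ∈ J, ε j ≤ C₁ * (g j * pj j))
    (hα3 : ∀ j ∈ J, C0 3 * (2 * C₁ * (g j * pj j)) ≤ 1 / 3) (hα2 : ∀ j ∈ J, 2 * (2 * C₁ * (g j * pj j)) ≤ c2' 3 P.L)
    (hsmall : ∀ j ∈ J, (2 * C₁ * (64 / 3 * C0 3 * C₁ ^ 2) + (64 / 3 * C0 3 * C₁ ^ 2) ^ 2) / 2 * g j * pj j ≤ 1 / 4) :
    (1 / 4 : ℝ) * ∑ j ∈ J, ∑ _p' ∈ S' j, pj j ^ 2 / 4 ≤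
      ((gk ^ 2)⁻¹ * (N : ℝ)) * wilsonAction ((P.L : ℝ) ^ k) U := by
  have hS'Λ : ∀ j ∈ J, S' j ⊆ plaqsIn j (lam42 (B10Eq71TorusOverlap.Ω M₁ R Ω₀ S) k j) :=
    fun j hj p hp => mem_plaqsIn_lam42 M₁ R Ω₀ S hR (hJk j hj) (hS j hj) (hS' j hj hp)
  have h67 := h67_of_constraint42 h42 J hJk S' hS'Λ
  refine quarter_sum_le_wilsonAction_of_regAt_specialUnitaryGroup M₁ R Ω₀ S hd hR hdiv J hJ hJk S' hS' hS U V g pj ε hC₁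
    hgj hgk hp hgp (fun j hj p' hp' => ?_) hLF h2 hε hα3 hα2 hsmall
  rw [h67 j hj p' hp', B10Eq27TorusAxialLog.plaqHol_toUField]
  rfl

/-- **THE SAME FROM A `LevelMin` PACKAGE AT LEVEL `k`** (the cell's reading of [7] Theorem 1 for (42)) with `U_k = U_k(y)`, `y = ofData k Λ V`,
and membership of `U_k` in the scale clauses of (2) (its provenance: §4): the small factors hold against `(N/g_k²)A^η(U_k)` under the
large-field condition and the coupling smallness only. [cite: Balaban1985UV3, (67)–(71) p.273, (42) p.266; Balaban1985Variational, Thm 1 (8) p.279, (2) p.278] -/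
theorem quarter_sum_le_actionEta_of_levelMin_regAt (hd : P.d = 3) (hR : ∀ i, 0 ≤ R i * M₁) (hdiv : P.L ∣ M₁)
    (J : Finset ℕ) (hJ : ∀ j ∈ J, j ≤ P.m + P.K) {k : ℕ} (hJk : ∀ j ∈ J, j ≤ k) (S' : (j : ℕ) → Finset (Plaq P j))
    (hS' : ∀ j ∈ J, S' j ⊆ S j)
    (hS : ∀ j ∈ J, S j ⊆ plaqsIn j (B10Eq71TorusOverlap.Ω M₁ R Ω₀ S j))
    {A : GaugeField P 0 (Matrix.unitaryGroup (Fin N) ℂ) → ℝ}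
    {Rg : KData P N → Set (GaugeField P 0 (Matrix.unitaryGroup (Fin N) ℂ))} {T : Set (KData P N)}
    {Uk : KData P N → GaugeField P 0 (Matrix.unitaryGroup (Fin N) ℂ)}
    (hL : LevelMin A (datum k (lam42 (B10Eq71TorusOverlap.Ω M₁ R Ω₀ S) k)) Rg T Uk)
    (V : (j : ℕ) → GaugeField P j (Matrix.unitaryGroup (Fin N) ℂ))
    (hV : ofData k (lam42 (B10Eq71TorusOverlap.Ω M₁ R Ω₀ S) k) V ∈ T)
    (g : ℕ → ℝ) (pj : ℕ → ℝ) (ε : ℕ → ℝ) {gk C₁ : ℝ} (hC₁ : 0 < C₁)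
    (hgj : ∀ j ∈ J, 0 < g j) (hgk : ∀ j ∈ J, gk ^ 2 = g j ^ 2 * (P.L : ℝ) ^ (k - j)) (hp : ∀ j ∈ J, 0 < pj j)
    (hgp : ∀ j ∈ J, g j * pj j ≤ 1)
    (hLF : ∀ j ∈ J, ∀ p' ∈ S' j, g j * pj j ≤ dist1 (GaugeField.plaqHol (V j) p'))
    (h2 : ∀ j ∈ J, RegAt j (B10Eq71TorusOverlap.Ω M₁ R Ω₀ S j) (ε j) (Uk (ofData k (lam42 (B10Eq71TorusOverlap.Ω M₁ R Ω₀ S) k) V)))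
    (hε : ∀ j ∈ J, ε j ≤ C₁ * (g j * pj j))
    (hα3 : ∀ j ∈ J, C0 3 * (2 * C₁ * (g j * pj j)) ≤ 1 / 3) (hα2 : ∀ j ∈ J, 2 * (2 * C₁ * (g j * pj j)) ≤ c2' 3 P.L)
    (hsmall : ∀ j ∈ J, (2 * C₁ * (64 / 3 * C0 3 * C₁ ^ 2) + (64 / 3 * C0 3 * C₁ ^ 2) ^ 2) / 2 * g j * pj j ≤ 1 / 4) :
    (1 / 4 : ℝ) * ∑ j ∈ J, ∑ _p' ∈ S' j, pj j ^ 2 / 4 ≤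
      ((gk ^ 2)⁻¹ * (N : ℝ)) * actionEta k (Uk (ofData k (lam42 (B10Eq71TorusOverlap.Ω M₁ R Ω₀ S) k) V)) :=
  quarter_sum_le_actionEta_of_constraint42_regAt M₁ R Ω₀ S hd hR hdiv J hJ hJk S' hS' hS _ V
    (isMin42_of_levelMin hL hV).constraint g pj ε hC₁ hgj hgk hp hgp hLF h2 hε hα3 hα2 hsmall

end Chain

/-! ## §6 (v1.1) THE COVARIANT-DERIVATIVE CLAUSE OF [7] (2) = [6] (1.9) ON THE TORUS, WITH BODY; THE FULL SPACE `U_k({Ω_j}, ε₀)`;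
## ITS GAUGE INVARIANCE; «it is enough to assume that (1.7), (1.9) hold for p, b ∈ B^j(Λ_j)»

[7] p. 278 (2), second clause: «|(D*_U∂U)(b)| < ε₀L^{−2j}(L^jη)^{−1} = ε₀η²(L^jη)^{−3} for b ∈ Ω_j».  [6] p. 76 (1.1)–(1.2): «(D^{η*}_{U,μ}F)(x)
= η⁻¹(R(U(x, x − ηe_μ))F(x − ηe_μ) − F(x))», «R(U)X = UXU⁻¹», «F_{μν}(x) = F(p_{μν}(x))», «(D^{η*}_U F)(x, x + ηe_μ) = (D^{η*}_U F)_μ(x) =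
Σ_{ν<μ}(D^{η*}_{U,ν}F_{νμ})(x) − Σ_{ν>μ}(D^{η*}_{U,ν}F_{μν})(x)»; p. 77: «we denote by Ω also the set of bonds ⋃_{x∈Ω} st(x) = {bonds b ⊂ T_η: at
least one end-point of b belongs to Ω}», (1.9) «|(D^{η*}_U ∂U)(b)| < α₀L^{−2j}(L^jη)^{−1} for b ∈ Ω_j, j = 0, 1, …, k», «Of course it is enough
to assume that (1.7), (1.9) hold for p, b ∈ B^j(Λ_j), because if these conditions hold for some j = l, then they hold for all j < l. These
conditions are invariant with respect to gauge transformations. … (D^{η*}_{U^u,ν}F^u)(x) = R(u(x))(D^{η*}_{U,ν}F)(x). (1.11) This and (1.2) imply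
the invariance.»  The cell typed all of this on `ℤ^d` (`B8Ineq132`: `covDeriv`, `plaqF`, `covDiv`, `CondAt`, `InAk`, (1.11) `covDiv_gaugeAct`,
`thr_mono`); THIS SECTION types it on the torus carrier of record `Setup.Site P s` for configurations with values in the units `𝔸ˣ` of the
lineage's Banach algebra (`U(N)` through `B10Eq27TorusAxialLog.unitsField`) and PROVES that on `T_η` the covariant divergence (1.2) IS the cell's
(1.2) of the periodic pullback `B10Eq27TorusAxialLog.pull` (`covDiv_pull`), so that (1.11) and the gauge invariance are TRANSPORTED from the
cell's theorems BY NAME.  The full space `U_k({Ω_j}, ε₀)` = BOTH clauses of (2) is `InSpaceA` (`InSpace` for the cell's `U(N)`, = §1's plaquette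
half `InSpace2` ∧ the divergence clauses, `inSpace_iff`); v1's HONEST SCOPE (i) («`InSpace2` is a SUPERSET of [7]'s space») is thereby made
precise: `InSpace.inSpace2`. -/

section CovariantDerivative

open B7Prop1Explicit renaming Site → LSite
open B7Prop1Explicit (e hol U1 disp_plaqWord hol_gaugeAct_closed)
open B7Prop2Explicit (unitaryUnits mem_unitaryUnits unitaryUnits_le_U1)
open B7Eq78Linearization (conjR conjR_apply)
open B8Ineq132 (plaqF covDeriv covDiv covDiv_gaugeAct norm_conjR thr_mono)
open B10Eq27TorusAxialLog (transl transl_zero transl_sub_e pull pull_apply gaugeActT gaugeActT_apply hol_pull hol_pull_zero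
  pull_gaugeActT gaugeActT_eq_gaugeAct unitsField val_unitsField norm_holT_unitsField_plaqWord_sub_one holT_one)
open B10Eq42TorusConstraint (lam42 lam42_of_lt lam42_self)

/-! ### §6.1 (1.1), (1.2) on the torus and the dictionary with the cell's `ℤ^d` objects -/

section Objects

variable {s : ℕ} {𝔸 : Type*} [NormedRing 𝔸] [NormedAlgebra ℂ 𝔸]

/-- **«b ∈ Ω»** for a bond `b = ⟨x, x + e_μ⟩` of the torus and a region `X`: at least one end-point of `b` in `X` ([6] p. 77 «we denote by Ω
also the set of bonds ⋃_{x∈Ω} st(x)»; the cell's `ℤ^d` reading `B8Ineq132.BondTouches`). [cite: Balaban1985RegularSpaces, p.77 (convention before (1.5)); Balaban1985Variational, (2) p.278] -/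
def BTouches (X : Set (Site P s)) (b : PBond P s) : Prop :=
  b.src ∈ X ∨ b.tgt ∈ X

/-- `BTouches` is monotone in the region. [cite: Balaban1985RegularSpaces, p.77 (convention before (1.5))] -/
theorem BTouches.mono {X Y : Set (Site P s)} (hXY : X ⊆ Y) {b : PBond P s} (h : BTouches X b) : BTouches Y b := by
  rcases h with h | h
  exacts [Or.inl (hXY h), Or.inr (hXY h)]

/-- **THE PLAQUETTE FIELD ON THE TORUS** `F_{μν}(x) = (∂U)(p_{μν}(x)) = U(∂p_{μν}(x))`: the transport of [4] (9) along the plaquette word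
`(+e_μ, +e_ν, −e_μ, −e_ν)` from `x` (`B10Eq27TorusAxialLog.holT`), read in `𝔸`. [cite: Balaban1985RegularSpaces, (1.2) p.76; Balaban1985Averaging, (9) p.19] -/
def plaqFT (V : GaugeField P s 𝔸ˣ) (μ ν : Fin P.d) (x : Site P s) : 𝔸 :=
  ((B10Eq27TorusAxialLog.holT V x (plaqWord μ ν) : 𝔸ˣ) : 𝔸)

/-- **[6] (1.1), second line, ON THE TORUS**: the backward covariant derivative `(D^{η*}_{U,ν}F)(x) = η⁻¹(R(U(x, x − ηe_ν))F(x − ηe_ν) − F(x))`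
with `U(x, x − e_ν) = U(x − e_ν, x)⁻¹` ([4] (9)) and `R(U)X = UXU⁻¹` (`B7Eq78Linearization.conjR`). [cite: Balaban1985RegularSpaces, (1.1) p.76] -/
def covDerivT (η : ℝ) (V : GaugeField P s 𝔸ˣ) (ν : Fin P.d) (F : Site P s → 𝔸) (x : Site P s) : 𝔸 :=
  η⁻¹ • (conjR (V ⟨x.unshift ν, ν⟩)⁻¹ (F (x.unshift ν)) - F x)

/-- **[6] (1.2) ON THE TORUS**: the covariant divergence of `F = ∂U` at the bond `⟨x, x + e_μ⟩`,
`(D^{η*}_U ∂U)_μ(x) = Σ_{ν<μ}(D^{η*}_{U,ν}F_{νμ})(x) − Σ_{ν>μ}(D^{η*}_{U,ν}F_{μν})(x)` — the quantity of the second clause of [7] (2).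
[cite: Balaban1985RegularSpaces, (1.2) p.76; Balaban1985Variational, (2) p.278] -/
def covDivT (η : ℝ) (V : GaugeField P s 𝔸ˣ) (μ : Fin P.d) (x : Site P s) : 𝔸 :=
  ∑ ν ∈ Finset.Iio μ, covDerivT η V ν (plaqFT V ν μ) x - ∑ ν ∈ Finset.Ioi μ, covDerivT η V ν (plaqFT V μ ν) x

omit [NormedAlgebra ℂ 𝔸] in
/-- **DICTIONARY, plaquette fields**: the cell's `ℤ^d` plaquette field of the periodic pullback based at `y`, read at `z`, is the torus plaquette
field at `y + z` (`B10Eq27TorusAxialLog.hol_pull`). [cite: Balaban1985RegularSpaces, (1.2) p.76; Balaban1985Averaging, (9) p.19] -/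
theorem plaqF_pull (V : GaugeField P s 𝔸ˣ) (y : Site P s) (μ ν : Fin P.d) (z : LSite P.d) :
    plaqF (pull V y) μ ν z = plaqFT V μ ν (transl y z) := by
  unfold plaqF plaqFT
  rw [hol_pull]

/-- **DICTIONARY, (1.1)**: the cell's backward covariant derivative of the pulled-back function along the pulled-back configuration is the
torus covariant derivative (`transl y (z − e_ν) = (y + z) − e_ν`). [cite: Balaban1985RegularSpaces, (1.1) p.76] -/
theorem covDeriv_pull (η : ℝ) (V : GaugeField P s 𝔸ˣ) (y : Site P s) (ν : Fin P.d) (F : Site P s → 𝔸) (z : LSite P.d) :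
    covDeriv η (pull V y) ν (fun z' => F (transl y z')) z = covDerivT η V ν F (transl y z) := by
  unfold covDeriv covDerivT
  simp only [pull_apply, transl_sub_e]

/-- **DICTIONARY, (1.2)**: `(D^{η*}_{V♯_y}∂V♯_y)_μ(z) = (D^{η*}_V ∂V)_μ(y + z)` — the covariant divergence (1.2) ON THE TORUS IS THE CELL'S (1.2)
(`B8Ineq132.covDiv`) OF THE PERIODIC PULLBACK. [cite: Balaban1985RegularSpaces, (1.2) p.76] -/
theorem covDiv_pull (η : ℝ) (V : GaugeField P s 𝔸ˣ) (y : Site P s) (μ : Fin P.d) (z : LSite P.d) :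
    covDiv η (pull V y) μ z = covDivT η V μ (transl y z) := by
  have h : ∀ κ μ' : Fin P.d, plaqF (pull V y) κ μ' = fun z' => plaqFT V κ μ' (transl y z') :=
    fun κ μ' => funext (plaqF_pull V y κ μ')
  unfold covDiv covDivT
  simp only [h, covDeriv_pull]

/-- The same read from the base point: `(D^{η*}_V ∂V)_μ(x) = (D^{η*}_{V♯_x}∂V♯_x)_μ(0)`. [cite: Balaban1985RegularSpaces, (1.2) p.76] -/
theorem covDivT_eq_covDiv_pull (η : ℝ) (V : GaugeField P s 𝔸ˣ) (μ : Fin P.d) (x : Site P s) :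
    covDivT η V μ x = covDiv η (pull V x) μ 0 := by
  rw [covDiv_pull, transl_zero]

omit [NormedAlgebra ℂ 𝔸] in
/-- **«(∂U^u)(p_{μν}(x)) = R(u(x))(∂U)(p_{μν}(x))»** ([6] p. 77) on the torus — transported from the cell's `B8Ineq132.plaqF_gaugeAct` through
`pull_gaugeActT`. [cite: Balaban1985RegularSpaces, p.77 (sentence before (1.11)); Balaban1985Averaging, (8) p.19] -/
theorem plaqFT_gaugeActT (u : GaugeTransf P s 𝔸ˣ) (V : GaugeField P s 𝔸ˣ) (μ ν : Fin P.d) (x : Site P s) :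
    plaqFT (gaugeActT u V) μ ν x = conjR (u x) (plaqFT V μ ν x) := by
  have h : plaqF (pull (gaugeActT u V) x) μ ν 0 = conjR (u (transl x 0)) (plaqF (pull V x) μ ν 0) := by
    rw [pull_gaugeActT]
    exact B8Ineq132.plaqF_gaugeAct _ _ μ ν 0
  rwa [plaqF_pull, plaqF_pull, transl_zero] at h

/-- **[6] (1.11) + (1.2) ON THE TORUS**: `(D^{η*}_{U^u}∂U^u)_μ(x) = R(u(x))(D^{η*}_U ∂U)_μ(x)` — transported from the cell's
`B8Ineq132.covDiv_gaugeAct` through the dictionary. [cite: Balaban1985RegularSpaces, (1.11) p.77, p.77 ("This and (1.2) imply the invariance")] -/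
theorem covDivT_gaugeActT (η : ℝ) (u : GaugeTransf P s 𝔸ˣ) (V : GaugeField P s 𝔸ˣ) (μ : Fin P.d) (x : Site P s) :
    covDivT η (gaugeActT u V) μ x = conjR (u x) (covDivT η V μ x) := by
  have h : covDiv η (pull (gaugeActT u V) x) μ 0 = conjR (u (transl x 0)) (covDiv η (pull V x) μ 0) := by
    rw [pull_gaugeActT]
    exact covDiv_gaugeAct η _ _ μ 0
  rwa [covDiv_pull, covDiv_pull, transl_zero] at h

/-- **THE `η`-BOOKKEEPING OF (1.1)/(1.2)**: `D^{η*} = η⁻¹·D^{1*}` (the prefactor of (1.1) is the only place the spacing enters).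
[cite: Balaban1985RegularSpaces, (1.1) p.76] -/
theorem covDivT_eq_smul (η : ℝ) (V : GaugeField P s 𝔸ˣ) (μ : Fin P.d) (x : Site P s) :
    covDivT η V μ x = η⁻¹ • covDivT 1 V μ x := by
  unfold covDivT covDerivT
  simp only [inv_one, one_smul, smul_sub, Finset.smul_sum]

/-- **NON-VACUITY**: the covariant divergence of the trivial configuration `U ≡ 1` vanishes at every bond (`F ≡ 1`, `R(1)1 − 1 = 0`).
[cite: Balaban1985RegularSpaces, (1.2) p.76] -/
theorem covDivT_one (η : ℝ) (μ : Fin P.d) (x : Site P s) : covDivT η (fun _ : PBond P s => (1 : 𝔸ˣ)) μ x = 0 := by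
  have hF : ∀ κ μ' : Fin P.d, plaqFT (fun _ : PBond P s => (1 : 𝔸ˣ)) κ μ' = fun _ => 1 := fun κ μ' => by
    funext z; unfold plaqFT; rw [holT_one, Units.val_one]
  unfold covDivT covDerivT
  simp only [hF, conjR_apply, inv_one, Units.val_one, mul_one, sub_self, smul_zero, Finset.sum_const_zero]

variable [NormOneClass 𝔸]

omit [NormedAlgebra ℂ 𝔸] in
/-- **Invariance of `|U(∂p) − 1|` on the torus** for gauge transformations with values in `{|u| ≤ 1, |u⁻¹| ≤ 1}` («It is obvious for (1.7)»,
[6] p. 77): `|R(u(x))F − 1| = |R(u(x))(F − 1)| = |F − 1|`. [cite: Balaban1985RegularSpaces, p.77 (last paragraph)] -/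
theorem norm_plaqFT_gaugeActT_sub_one {u : GaugeTransf P s 𝔸ˣ} (hu : ∀ x, u x ∈ U1 𝔸) (V : GaugeField P s 𝔸ˣ) (μ ν : Fin P.d)
    (x : Site P s) : ‖plaqFT (gaugeActT u V) μ ν x - 1‖ = ‖plaqFT V μ ν x - 1‖ := by
  have h1 : conjR (u x) (plaqFT V μ ν x) - 1 = conjR (u x) (plaqFT V μ ν x - 1) := by
    rw [B7Eq78Linearization.conjR_sub, B7Eq78Linearization.conjR_one]
  rw [plaqFT_gaugeActT, h1, norm_conjR (hu x)]

/-- **Gauge invariance of `|(D^{η*}_U ∂U)(b)|` on the torus** for gauge transformations with values in `{|u| ≤ 1, |u⁻¹| ≤ 1}` ([6] p. 77 «This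
and (1.2) imply the invariance»). [cite: Balaban1985RegularSpaces, p.77 (last paragraph), (1.11)] -/
theorem norm_covDivT_gaugeActT (η : ℝ) {u : GaugeTransf P s 𝔸ˣ} (hu : ∀ x, u x ∈ U1 𝔸) (V : GaugeField P s 𝔸ˣ) (μ : Fin P.d)
    (x : Site P s) : ‖covDivT η (gaugeActT u V) μ x‖ = ‖covDivT η V μ x‖ := by
  rw [covDivT_gaugeActT, norm_conjR (hu x)]

end Objects

/-! ### §6.2 The clauses of (2) at one scale on one region, the full space `U_k({Ω_j}, ε₀)`, the `U(N)` dictionary -/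

section Clauses

variable {𝔸 : Type*} [NormedRing 𝔸] [NormedAlgebra ℂ 𝔸]

/-- **THE SCALE-`j` COVARIANT-DERIVATIVE CLAUSE OF [7] (2) = [6] (1.9) WITH BODY ON THE TORUS**: «|(D*_U∂U)(b)| < ε₀L^{−2j}(L^jη)^{−1} for
b ∈ Ω_j» — for every bond `b` of `T_η` with an end-point in the region `X` (print: `X = Ω_j`), `‖(D^{η*}_V ∂V)(b)‖ < ε·(L^j)⁻²·(L^jη)⁻¹` (the
threshold letters of the cell's `B8Ineq132.CondAt`). [cite: Balaban1985Variational, (2) p.278; Balaban1985RegularSpaces, (1.9) p.77] -/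
def RegDivAt (j : ℕ) (X : Set (Site P 0)) (ε η : ℝ) (V : GaugeField P 0 𝔸ˣ) : Prop :=
  ∀ b : PBond P 0, BTouches X b → ‖covDivT η V b.dir b.src‖ < ε * (((P.L : ℝ) ^ j)⁻¹) ^ 2 * ((P.L : ℝ) ^ j * η)⁻¹

/-- **THE SCALE-`j` PLAQUETTE CLAUSE OF [7] (2) = [6] (1.7) IN THE BANACH-ALGEBRA LETTERS**: «|U(∂p) − 1| < ε₀L^{−2j} for p ∈ Ω_j» for
`𝔸ˣ`-valued configurations (`‖F_{μν}(x) − 1‖`); for the cell's `U(N)` it IS §1's `RegAt` (`regPlaqAt_unitsField_iff`).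
[cite: Balaban1985Variational, (2) p.278; Balaban1985RegularSpaces, (1.7) p.77] -/
def RegPlaqAt (j : ℕ) (X : Set (Site P 0)) (ε : ℝ) (V : GaugeField P 0 𝔸ˣ) : Prop :=
  ∀ q : Plaq P 0, Touches X q → ‖plaqFT V q.μ q.ν q.src - 1‖ < ε * (((P.L : ℝ) ^ j)⁻¹) ^ 2

/-- **`V ∈ U_k({Ω_j}, ε₀)` IN FULL** — BOTH clauses of [7] (2) for all `j ≤ k`: «|U(∂p) − 1| < ε₀L^{−2j} for p ∈ Ω_j, j = 0, 1, …, k,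
|(D*_U∂U)(b)| < ε₀L^{−2j}(L^jη)^{−1} for b ∈ Ω_j» (= the cell's `ℤ^d` class `B8Ineq132.InAk`, [6] (1.7)/(1.9), on the torus).
[cite: Balaban1985Variational, (2) p.278, (8) p.279; Balaban1985RegularSpaces, (1.7), (1.9) p.77] -/
def InSpaceA (k : ℕ) (Ω : ℕ → Set (Site P 0)) (ε₀ η : ℝ) (V : GaugeField P 0 𝔸ˣ) : Prop :=
  ∀ j, j ≤ k → RegPlaqAt j (Ω j) ε₀ V ∧ RegDivAt j (Ω j) ε₀ η V

/-- Unfolding `RegDivAt` at one bond. [cite: Balaban1985Variational, (2) p.278] -/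
theorem RegDivAt.lt {j : ℕ} {X : Set (Site P 0)} {ε η : ℝ} {V : GaugeField P 0 𝔸ˣ} (h : RegDivAt j X ε η V) {b : PBond P 0}
    (hb : BTouches X b) : ‖covDivT η V b.dir b.src‖ < ε * (((P.L : ℝ) ^ j)⁻¹) ^ 2 * ((P.L : ℝ) ^ j * η)⁻¹ :=
  h b hb

/-- The scale-`j` clauses of a member of `U_k({Ω_j}, ε₀)`. [cite: Balaban1985Variational, (2) p.278] -/
theorem InSpaceA.clauses {k : ℕ} {Ω : ℕ → Set (Site P 0)} {ε₀ η : ℝ} {V : GaugeField P 0 𝔸ˣ} (h : InSpaceA k Ω ε₀ η V) {j : ℕ}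
    (hj : j ≤ k) : RegPlaqAt j (Ω j) ε₀ V ∧ RegDivAt j (Ω j) ε₀ η V :=
  h j hj

/-- `RegDivAt` is monotone in the constant (for `η ≥ 0`). [cite: Balaban1985Variational, (2) p.278] -/
theorem RegDivAt.mono_eps {j : ℕ} {X : Set (Site P 0)} {ε ε' η : ℝ} (hε : ε ≤ ε') (hη : 0 ≤ η) {V : GaugeField P 0 𝔸ˣ}
    (h : RegDivAt j X ε η V) : RegDivAt j X ε' η V := by
  intro b hb
  have hL : (0 : ℝ) ≤ (P.L : ℝ) ^ j := by positivity
  exact lt_of_lt_of_le (h b hb)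
    (mul_le_mul_of_nonneg_right (mul_le_mul_of_nonneg_right hε (sq_nonneg _)) (inv_nonneg.mpr (mul_nonneg hL hη)))

/-- `RegDivAt` is monotone under shrinking the region. [cite: Balaban1985Variational, (2) p.278] -/
theorem RegDivAt.of_subset {j : ℕ} {X Y : Set (Site P 0)} (hXY : X ⊆ Y) {ε η : ℝ} {V : GaugeField P 0 𝔸ˣ}
    (h : RegDivAt j Y ε η V) : RegDivAt j X ε η V :=
  fun b hb => h b (hb.mono hXY)

omit [NormedAlgebra ℂ 𝔸] in
/-- `RegPlaqAt` is monotone in the constant. [cite: Balaban1985Variational, (2) p.278] -/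
theorem RegPlaqAt.mono_eps {j : ℕ} {X : Set (Site P 0)} {ε ε' : ℝ} (hε : ε ≤ ε') {V : GaugeField P 0 𝔸ˣ} (h : RegPlaqAt j X ε V) :
    RegPlaqAt j X ε' V :=
  fun q hq => lt_of_lt_of_le (h q hq) (mul_le_mul_of_nonneg_right hε (sq_nonneg _))

omit [NormedAlgebra ℂ 𝔸] in
/-- `RegPlaqAt` is monotone under shrinking the region. [cite: Balaban1985Variational, (2) p.278] -/
theorem RegPlaqAt.of_subset {j : ℕ} {X Y : Set (Site P 0)} (hXY : X ⊆ Y) {ε : ℝ} {V : GaugeField P 0 𝔸ˣ} (h : RegPlaqAt j Y ε V) :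
    RegPlaqAt j X ε V :=
  fun q hq => h q (hq.mono hXY)

/-- **«if these conditions hold for some j = l, then they hold for all j < l»** ([6] p. 77) — the divergence clause: the thresholds
`εL^{−2l}(L^lη)^{−1}` decrease in `l` (`B8Ineq132.thr_mono` BY NAME; `ε ≥ 0`, `η > 0`). [cite: Balaban1985RegularSpaces, p.77 (sentence after (1.10))] -/
theorem RegDivAt.of_le_level {j l : ℕ} (hjl : j ≤ l) {X : Set (Site P 0)} {ε η : ℝ} (hε : 0 ≤ ε) (hη : 0 < η) {V : GaugeField P 0 𝔸ˣ}
    (h : RegDivAt l X ε η V) : RegDivAt j X ε η V :=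
  fun b hb => (h b hb).trans_le (thr_mono P.L_pos hε hη hjl).2

omit [NormedAlgebra ℂ 𝔸] in
/-- **«if these conditions hold for some j = l, then they hold for all j < l»** ([6] p. 77) — the plaquette clause, Banach-algebra letters.
[cite: Balaban1985RegularSpaces, p.77 (sentence after (1.10))] -/
theorem RegPlaqAt.of_le_level {j l : ℕ} (hjl : j ≤ l) {X : Set (Site P 0)} {ε : ℝ} (hε : 0 ≤ ε) {V : GaugeField P 0 𝔸ˣ}
    (h : RegPlaqAt l X ε V) : RegPlaqAt j X ε V :=
  fun q hq => (h q hq).trans_le (thr_mono P.L_pos hε one_pos hjl).1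

/-- Fewer levels: `U_k({Ω_j}, ε₀) ⊆ U_{k′}({Ω_j}_{j≤k′}, ε₀)` for `k′ ≤ k`. [cite: Balaban1985Variational, (2) p.278] -/
theorem InSpaceA.mono_levels {k k' : ℕ} (hk : k' ≤ k) {Ω : ℕ → Set (Site P 0)} {ε₀ η : ℝ} {V : GaugeField P 0 𝔸ˣ}
    (h : InSpaceA k Ω ε₀ η V) : InSpaceA k' Ω ε₀ η V :=
  fun j hj => h j (hj.trans hk)

/-- Larger constant: `U_k({Ω_j}, ε₀) ⊆ U_k({Ω_j}, ε₀′)` for `ε₀ ≤ ε₀′` (e.g. (8) ⊆ (6) when `B₃ε₁ ≤ ε₀`, [7] p. 279), `η ≥ 0`.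
[cite: Balaban1985Variational, (2) p.278, Thm 1 p.279] -/
theorem InSpaceA.mono_eps {k : ℕ} {Ω : ℕ → Set (Site P 0)} {ε₀ ε₀' η : ℝ} (hε : ε₀ ≤ ε₀') (hη : 0 ≤ η) {V : GaugeField P 0 𝔸ˣ}
    (h : InSpaceA k Ω ε₀ η V) : InSpaceA k Ω ε₀' η V :=
  fun j hj => ⟨(h j hj).1.mono_eps hε, (h j hj).2.mono_eps hε hη⟩

/-- **THE `η`-FREE FORM OF THE DIVERGENCE CLAUSE** (the analogue for (1.9) of the cell's `threshold_18` for (1.8) ⟺ (1.7)): since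
`D^{η*} = η⁻¹D^{1*}`, for `η > 0` the clause «‖(D^{η*}_V∂V)(b)‖ < εL^{−2j}(L^jη)^{−1}» IS «‖(D^{1*}_V∂V)(b)‖ < εL^{−3j}» — on `T_η` the spacing
drops out of (2) entirely. [cite: Balaban1985RegularSpaces, (1.8)–(1.9) p.77; Balaban1985Variational, (2) p.278] -/
theorem regDivAt_iff_unit {j : ℕ} {X : Set (Site P 0)} {ε η : ℝ} (hη : 0 < η) (V : GaugeField P 0 𝔸ˣ) :
    RegDivAt j X ε η V ↔ ∀ b : PBond P 0, BTouches X b → ‖covDivT 1 V b.dir b.src‖ < ε * (((P.L : ℝ) ^ j)⁻¹) ^ 3 := by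
  have key : ∀ a : ℝ, η⁻¹ * a < ε * (((P.L : ℝ) ^ j)⁻¹) ^ 2 * ((P.L : ℝ) ^ j * η)⁻¹ ↔ a < ε * (((P.L : ℝ) ^ j)⁻¹) ^ 3 := by
    intro a
    rw [show ε * (((P.L : ℝ) ^ j)⁻¹) ^ 2 * ((P.L : ℝ) ^ j * η)⁻¹ = η⁻¹ * (ε * (((P.L : ℝ) ^ j)⁻¹) ^ 3) by
      rw [mul_inv]; ring]
    exact mul_lt_mul_iff_of_pos_left (inv_pos.mpr hη)
  refine forall₂_congr fun b _ => ?_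
  rw [covDivT_eq_smul η, norm_smul, Real.norm_eq_abs, abs_of_pos (inv_pos.mpr hη)]
  exact key _

/-- **NON-VACUITY**: the trivial configuration satisfies both clauses at every scale with any `ε > 0`, `η > 0`.
[cite: Balaban1985Variational, (2) p.278] -/
theorem inSpaceA_one (k : ℕ) (Ω : ℕ → Set (Site P 0)) {ε₀ η : ℝ} (hε : 0 < ε₀) (hη : 0 < η) :
    InSpaceA k Ω ε₀ η (fun _ : PBond P 0 => (1 : 𝔸ˣ)) := by
  have hL : ∀ j : ℕ, (0 : ℝ) < (P.L : ℝ) ^ j := fun j => by have := P.L_pos; positivity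
  refine fun j _ => ⟨fun q _ => ?_, fun b _ => ?_⟩
  · unfold plaqFT
    rw [holT_one, Units.val_one, sub_self, norm_zero]
    exact mul_pos hε (by have := hL j; positivity)
  · rw [covDivT_one, norm_zero]
    have := hL j
    positivity

variable [NormOneClass 𝔸]

/-- **The divergence clause is gauge invariant** ([6] p. 77, via (1.11)) for gauge transformations with values in `{|u| ≤ 1, |u⁻¹| ≤ 1}`.
[cite: Balaban1985RegularSpaces, p.77 (last paragraph), (1.11); Balaban1985Variational, p.278 (sentence after (3))] -/
theorem regDivAt_gaugeActT_iff {j : ℕ} {X : Set (Site P 0)} {ε η : ℝ} {u : GaugeTransf P 0 𝔸ˣ} (hu : ∀ x, u x ∈ U1 𝔸)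
    (V : GaugeField P 0 𝔸ˣ) : RegDivAt j X ε η (gaugeActT u V) ↔ RegDivAt j X ε η V := by
  unfold RegDivAt
  simp only [norm_covDivT_gaugeActT η hu]

omit [NormedAlgebra ℂ 𝔸] in
/-- **The plaquette clause is gauge invariant** ([6] p. 77 «It is obvious for (1.7)») for gauge transformations with values in
`{|u| ≤ 1, |u⁻¹| ≤ 1}`. [cite: Balaban1985RegularSpaces, p.77 (last paragraph); Balaban1985Variational, p.278 (sentence after (3))] -/
theorem regPlaqAt_gaugeActT_iff {j : ℕ} {X : Set (Site P 0)} {ε : ℝ} {u : GaugeTransf P 0 𝔸ˣ} (hu : ∀ x, u x ∈ U1 𝔸)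
    (V : GaugeField P 0 𝔸ˣ) : RegPlaqAt j X ε (gaugeActT u V) ↔ RegPlaqAt j X ε V := by
  unfold RegPlaqAt
  simp only [norm_plaqFT_gaugeActT_sub_one hu]

/-- **[7] p. 278 «The space U_k({Ω_j}, ε₀) is gauge invariant» — PROVED FOR THE FULL SPACE** (both clauses, every `j ≤ k`), for gauge
transformations with values in `{|u| ≤ 1, |u⁻¹| ≤ 1}` (so for all unitary-valued ones). [cite: Balaban1985Variational, p.278 (sentence after (3)); Balaban1985RegularSpaces, p.77 (last paragraph)] -/
theorem inSpaceA_gaugeActT_iff {k : ℕ} {Ω : ℕ → Set (Site P 0)} {ε₀ η : ℝ} {u : GaugeTransf P 0 𝔸ˣ} (hu : ∀ x, u x ∈ U1 𝔸)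
    (V : GaugeField P 0 𝔸ˣ) : InSpaceA k Ω ε₀ η (gaugeActT u V) ↔ InSpaceA k Ω ε₀ η V := by
  unfold InSpaceA
  simp only [regDivAt_gaugeActT_iff hu, regPlaqAt_gaugeActT_iff hu]

end Clauses

/-! ### §6.3 «it is enough to assume that (1.7), (1.9) hold for p, b ∈ B^j(Λ_j)» on the torus, with print's `Λ_j` of (42) -/

section Layers

variable {𝔸 : Type*} [NormedRing 𝔸] [NormedAlgebra ℂ 𝔸]

/-- A point `v ∈ Ω_j`, `j ≤ k`, lies in `Λ_l` (`B10Eq42TorusConstraint.lam42 Ω k l`: `Ω_l∖Ω_{l+1}` for `l < k`, `Ω_k` for `l = k`) for the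
largest `l ∈ [j, k]` with `v ∈ Ω_l` (the torus twin of the cell's `B8Ineq132.exists_layer`). [cite: Balaban1985RegularSpaces, (1.5) p.77; Balaban1985UV3, (42) p.266] -/
theorem exists_lam42 {Ω : ℕ → Set (Site P 0)} {k j : ℕ} {v : Site P 0} (hjk : j ≤ k) (hv : v ∈ Ω j) :
    ∃ l, j ≤ l ∧ l ≤ k ∧ v ∈ lam42 Ω k l := by
  classical
  set l := Nat.findGreatest (fun l => v ∈ Ω l) k with hl
  have hjl : j ≤ l := Nat.le_findGreatest (P := fun l => v ∈ Ω l) hjk hv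
  have hlk : l ≤ k := Nat.findGreatest_le k
  have hvl : v ∈ Ω l := Nat.findGreatest_spec (P := fun l => v ∈ Ω l) hjk hv
  refine ⟨l, hjl, hlk, ?_⟩
  rcases hlk.lt_or_eq with hlt | heq
  · rw [lam42_of_lt hlt]
    exact ⟨hvl, fun hmem => Nat.findGreatest_is_greatest (P := fun l => v ∈ Ω l) (Nat.lt_succ_self l) (by omega) hmem⟩
  · rw [heq, lam42_self]
    exact heq ▸ hvl

/-- **[6] p. 77 «Of course it is enough to assume that (1.7), (1.9) hold for p, b ∈ B^j(Λ_j), because if these conditions hold for some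
j = l, then they hold for all j < l»** ON THE TORUS: the two clauses at level `l` on `Λ_l = lam42 Ω k l`, `l ≤ k`, give `V ∈ U_k({Ω_j}, ε₀)`
(`ε₀ ≥ 0`, `η > 0`; no nesting of the `Ω_j` is needed, as in the cell's `B8Ineq132.inAk_of_layers`). [cite: Balaban1985RegularSpaces, p.77 (sentence after (1.10)); Balaban1985Variational, (2)–(3) p.278] -/
theorem inSpaceA_of_lam42 {k : ℕ} {Ω : ℕ → Set (Site P 0)} {ε₀ η : ℝ} (hε : 0 ≤ ε₀) (hη : 0 < η) {V : GaugeField P 0 𝔸ˣ}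
    (h : ∀ l, l ≤ k → RegPlaqAt l (lam42 Ω k l) ε₀ V ∧ RegDivAt l (lam42 Ω k l) ε₀ η V) : InSpaceA k Ω ε₀ η V := by
  intro j hjk
  constructor
  · intro q hq
    have main : ∀ v, v ∈ Ω j → (∀ T : Set (Site P 0), v ∈ T → Touches T q) →
        ‖plaqFT V q.μ q.ν q.src - 1‖ < ε₀ * (((P.L : ℝ) ^ j)⁻¹) ^ 2 := fun v hv hT => by
      obtain ⟨l, hjl, hlk, hvl⟩ := exists_lam42 hjk hv
      exact ((h l hlk).1.of_le_level hjl hε) q (hT _ hvl)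
    rcases hq with hv | hv | hv | hv
    exacts [main _ hv fun T hT => Or.inl hT, main _ hv fun T hT => Or.inr (Or.inl hT),
      main _ hv fun T hT => Or.inr (Or.inr (Or.inl hT)), main _ hv fun T hT => Or.inr (Or.inr (Or.inr hT))]
  · intro b hb
    have main : ∀ v, v ∈ Ω j → (∀ T : Set (Site P 0), v ∈ T → BTouches T b) →
        ‖covDivT η V b.dir b.src‖ < ε₀ * (((P.L : ℝ) ^ j)⁻¹) ^ 2 * ((P.L : ℝ) ^ j * η)⁻¹ := fun v hv hT => by
      obtain ⟨l, hjl, hlk, hvl⟩ := exists_lam42 hjk hv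
      exact ((h l hlk).2.of_le_level hjl hε hη) b (hT _ hvl)
    rcases hb with hv | hv
    exacts [main _ hv fun T hT => Or.inl hT, main _ hv fun T hT => Or.inr hT]

variable {G : Type*} [GaugeGroup G]

/-- The same monotonicity for §1's `GaugeGroup` plaquette clause: level `l` implies level `j ≤ l` (`ε ≥ 0`).
[cite: Balaban1985RegularSpaces, p.77 (sentence after (1.10)); Balaban1985Variational, (2) p.278] -/
theorem RegAt.of_le_level {j l : ℕ} (hjl : j ≤ l) {X : Set (Site P 0)} {ε : ℝ} (hε : 0 ≤ ε) {U : GaugeField P 0 G}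
    (h : RegAt l X ε U) : RegAt j X ε U :=
  fun q hq => (h q hq).trans_le (thr_mono P.L_pos hε one_pos hjl).1

/-- **«enough on B^j(Λ_j)»** for §1's plaquette half `InSpace2` (any `GaugeGroup`): the scale-`l` clause on `Λ_l = lam42 Ω k l`, `l ≤ k`, gives
the plaquette half of `U_k({Ω_j}, ε₀)`. [cite: Balaban1985RegularSpaces, p.77 (sentence after (1.10)); Balaban1985Variational, (2) p.278] -/
theorem inSpace2_of_lam42 {k : ℕ} {Ω : ℕ → Set (Site P 0)} {ε₀ : ℝ} (hε : 0 ≤ ε₀) {U : GaugeField P 0 G}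
    (h : ∀ l, l ≤ k → RegAt l (lam42 Ω k l) ε₀ U) : InSpace2 k Ω ε₀ U := by
  intro j hjk q hq
  have main : ∀ v, v ∈ Ω j → (∀ T : Set (Site P 0), v ∈ T → Touches T q) →
      dist1 (GaugeField.plaqHol U q) < ε₀ * (((P.L : ℝ) ^ j)⁻¹) ^ 2 := fun v hv hT => by
    obtain ⟨l, hjl, hlk, hvl⟩ := exists_lam42 hjk hv
    exact ((h l hlk).of_le_level hjl hε) q (hT _ hvl)
  rcases hq with hv | hv | hv | hv
  exacts [main _ hv fun T hT => Or.inl hT, main _ hv fun T hT => Or.inr (Or.inl hT),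
    main _ hv fun T hT => Or.inr (Or.inr (Or.inl hT)), main _ hv fun T hT => Or.inr (Or.inr (Or.inr hT))]

end Layers

/-! ### §6.4 The cell's `U(N)`: the full space `InSpace`, = §1's plaquette half ∧ the divergence clauses; gauge invariance; `SU(N)` -/

section UnitaryGroup

open scoped Matrix.Norms.L2Operator

variable {N : ℕ} [NeZero N]

/-- **THE PLAQUETTE CLAUSE IN THE 𝔸-LETTERS IS §1's `RegAt` FOR THE CELL'S `U(N)`** (`dist1 W = ‖W − 1‖_op`,
`B10Eq27TorusAxialLog.norm_holT_unitsField_plaqWord_sub_one`). [cite: Balaban1985Variational, (2) p.278; Balaban1985Averaging, (19) p.21] -/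
theorem regPlaqAt_unitsField_iff {j : ℕ} {X : Set (Site P 0)} {ε : ℝ} (U : GaugeField P 0 (Matrix.unitaryGroup (Fin N) ℂ)) :
    RegPlaqAt j X ε (unitsField U) ↔ RegAt j X ε U := by
  refine forall₂_congr fun q _ => ?_
  unfold plaqFT
  rw [norm_holT_unitsField_plaqWord_sub_one U q.src q.hμν]

/-- **`U ∈ U_k({Ω_j}, ε₀)` FOR THE CELL'S `U(N)`-VALUED TORUS CONFIGURATIONS** — both clauses of [7] (2), read in `M_N(ℂ)` through
`unitsField`. [cite: Balaban1985Variational, (2) p.278, (8) p.279] -/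
def InSpace (k : ℕ) (Ω : ℕ → Set (Site P 0)) (ε₀ η : ℝ) (U : GaugeField P 0 (Matrix.unitaryGroup (Fin N) ℂ)) : Prop :=
  InSpaceA k Ω ε₀ η (unitsField U)

/-- **`U_k({Ω_j}, ε₀)` = §1's PLAQUETTE HALF ∧ THE DIVERGENCE CLAUSES** (v1's HONEST SCOPE (i) made precise: `InSpace2` is the first factor).
[cite: Balaban1985Variational, (2) p.278] -/
theorem inSpace_iff {k : ℕ} {Ω : ℕ → Set (Site P 0)} {ε₀ η : ℝ} (U : GaugeField P 0 (Matrix.unitaryGroup (Fin N) ℂ)) :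
    InSpace k Ω ε₀ η U ↔ InSpace2 k Ω ε₀ U ∧ ∀ j, j ≤ k → RegDivAt j (Ω j) ε₀ η (unitsField U) := by
  unfold InSpace InSpaceA InSpace2
  simp only [regPlaqAt_unitsField_iff]
  exact ⟨fun h => ⟨fun j hj => (h j hj).1, fun j hj => (h j hj).2⟩, fun h j hj => ⟨h.1 j hj, h.2 j hj⟩⟩

/-- A member of the full space lies in §1's plaquette half — so EVERY theorem of §§2–5 applies to it. [cite: Balaban1985Variational, (2) p.278] -/
theorem InSpace.inSpace2 {k : ℕ} {Ω : ℕ → Set (Site P 0)} {ε₀ η : ℝ} {U : GaugeField P 0 (Matrix.unitaryGroup (Fin N) ℂ)}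
    (h : InSpace k Ω ε₀ η U) : InSpace2 k Ω ε₀ U :=
  ((inSpace_iff U).mp h).1

/-- The divergence clauses of a member of the full space. [cite: Balaban1985Variational, (2) p.278] -/
theorem InSpace.regDivAt {k : ℕ} {Ω : ℕ → Set (Site P 0)} {ε₀ η : ℝ} {U : GaugeField P 0 (Matrix.unitaryGroup (Fin N) ℂ)}
    (h : InSpace k Ω ε₀ η U) {j : ℕ} (hj : j ≤ k) : RegDivAt j (Ω j) ε₀ η (unitsField U) :=
  ((inSpace_iff U).mp h).2 j hj

/-- `unitsField` intertwines the two gauge actions (`Setup`'s on `U(N)`, the lineage's `gaugeActT` on the units of `M_N(ℂ)`).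
[cite: Balaban1985Averaging, (8) p.19] -/
theorem unitsField_gaugeAct (u : GaugeTransf P 0 (Matrix.unitaryGroup (Fin N) ℂ)) (U : GaugeField P 0 (Matrix.unitaryGroup (Fin N) ℂ)) :
    unitsField (GaugeField.gaugeAct u U) = gaugeActT (fun x => Unitary.toUnits (u x)) (unitsField U) := by
  funext b
  apply Units.ext
  rw [val_unitsField, gaugeActT_apply]
  rfl

/-- The trivial `U(N)` configuration read in the units is the trivial units configuration. [cite: Balaban1985Averaging, (19) p.21] -/
theorem unitsField_one : unitsField (1 : GaugeField P 0 (Matrix.unitaryGroup (Fin N) ℂ)) = fun _ => 1 := by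
  funext b
  apply Units.ext
  rw [val_unitsField]
  rfl

/-- **NON-VACUITY for `U(N)`**: `U ≡ 1 ∈ U_k({Ω_j}, ε₀)` for every `ε₀ > 0`, `η > 0`. [cite: Balaban1985Variational, (2) p.278] -/
theorem inSpace_one (k : ℕ) (Ω : ℕ → Set (Site P 0)) {ε₀ η : ℝ} (hε : 0 < ε₀) (hη : 0 < η) :
    InSpace k Ω ε₀ η (1 : GaugeField P 0 (Matrix.unitaryGroup (Fin N) ℂ)) := by
  unfold InSpace
  rw [unitsField_one]
  exact inSpaceA_one k Ω hε hη

/-- **[7] p. 278 «The space U_k({Ω_j}, ε₀) is gauge invariant» FOR THE CELL'S `U(N)`, FULL SPACE** (unitary gauge transformations have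
operator norm `1`). [cite: Balaban1985Variational, p.278 (sentence after (3)); Balaban1985RegularSpaces, p.77 (last paragraph)] -/
theorem inSpace_gaugeAct_iff {k : ℕ} {Ω : ℕ → Set (Site P 0)} {ε₀ η : ℝ} (u : GaugeTransf P 0 (Matrix.unitaryGroup (Fin N) ℂ))
    (U : GaugeField P 0 (Matrix.unitaryGroup (Fin N) ℂ)) : InSpace k Ω ε₀ η (GaugeField.gaugeAct u U) ↔ InSpace k Ω ε₀ η U := by
  letI : CStarAlgebra (Matrix (Fin N) (Fin N) ℂ) := B10Eq29TubeLine.cstarAlgebraMatrix N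
  have hu : ∀ x, Unitary.toUnits (u x) ∈ U1 (Matrix (Fin N) (Fin N) ℂ) :=
    fun x => unitaryUnits_le_U1 (mem_unitaryUnits.mpr (u x).2)
  unfold InSpace
  rw [unitsField_gaugeAct]
  exact inSpaceA_gaugeActT_iff hu (unitsField U)

/-- **THE FULL SPACE FEEDS §4**: a level-`(j+1)` package whose space (8) is contained in the FULL `U_{j+1}({Ω_i}, B₃ε₁^{[j+1]})` satisfies
§4's dictionary clause `hR8` (containment in the plaquette half), so `regAt_of_crit_nested` reads (68) off it.
[cite: Balaban1985UV3, (68) p.273; Balaban1985Variational, Thm 1 (8) p.279, (2) p.278] -/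
theorem hR8_of_inSpace {Y : Type*} {R8 : Y → Set (GaugeField P 0 (Matrix.unitaryGroup (Fin N) ℂ))} {j : ℕ} {Ω : ℕ → Set (Site P 0)}
    {ε η : ℝ} (h : ∀ y, R8 y ⊆ {U | InSpace (j + 1) Ω ε η U}) : ∀ y, R8 y ⊆ {U | InSpace2 (j + 1) Ω ε U} :=
  fun y _ hU => (h y hU).inSpace2

/-- The `SU(N)`-valued configurations of Theorem 1 (p. 257 «semi-simple»): membership in the full space is read through `SU(N) ≤ U(N)`
(`B10Eq27TorusAxialLog.toUField`), and its plaquette half is §1's `InSpace2` of the `SU(N)`-valued field itself (`dist1` agrees,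
`dist1_plaqHol_toUField`). [cite: Balaban1985Variational, (2) p.278; Balaban1985UV3, Thm 1 p.257] -/
theorem inSpace2_of_inSpace_toUField {k : ℕ} {Ω : ℕ → Set (Site P 0)} {ε₀ η : ℝ}
    {U : GaugeField P 0 (Matrix.specialUnitaryGroup (Fin N) ℂ)} (h : InSpace k Ω ε₀ η (toUField U)) : InSpace2 k Ω ε₀ U := by
  intro j hj q hq
  have h' := (h.inSpace2 j hj) q hq
  rwa [B10Eq27TorusAxialLog.dist1_plaqHol_toUField] at h'

end UnitaryGroup

/-! ### §6.5 The assembled chain of §5 for members of the full spaces -/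

section ChainFull

open scoped Matrix.Norms.L2Operator
open B10Eq42TorusConstraint (Constraint42 actionEta)

variable (M₁ : ℕ) (R : ℕ → ℝ) (Ω₀ : Set (Site P 0)) (S : (j : ℕ) → Finset (Plaq P j))
variable {N : ℕ} [NeZero N]

/-- **SECT. D's SMALL FACTORS FROM (42) AND MEMBERSHIP IN THE FULL SPACES (8)** (`G = U(N)`, `d = 3`): as
`quarter_sum_le_actionEta_of_constraint42_regAt`, with the scale-`j` input now «`U_k ∈ U_{j+1}({Ω_i}, ε_j)` in full» (both clauses of (2) up to
level `j+1`, the shape §4 produces: the space (8) of `U_k`'s own `(j+1)`-datum) for every `j ∈ J`, `ε_j ≤ C₁g_jp(g_j)`.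
[cite: Balaban1985UV3, (67)–(71) p.273, (42) p.266, (41) p.266, (5) p.256; Balaban1985Variational, (2) p.278, (8) p.279] -/
theorem quarter_sum_le_actionEta_of_constraint42_inSpace (hd : P.d = 3) (hR : ∀ i, 0 ≤ R i * M₁) (hdiv : P.L ∣ M₁)
    (J : Finset ℕ) (hJ : ∀ j ∈ J, j ≤ P.m + P.K) {k : ℕ} (hJk : ∀ j ∈ J, j ≤ k) (S' : (j : ℕ) → Finset (Plaq P j))
    (hS' : ∀ j ∈ J, S' j ⊆ S j)
    (hS : ∀ j ∈ J, S j ⊆ plaqsIn j (B10Eq71TorusOverlap.Ω M₁ R Ω₀ S j))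
    (U : GaugeField P 0 (Matrix.unitaryGroup (Fin N) ℂ)) (V : (j : ℕ) → GaugeField P j (Matrix.unitaryGroup (Fin N) ℂ))
    (h42 : Constraint42 k (lam42 (B10Eq71TorusOverlap.Ω M₁ R Ω₀ S) k) V U)
    (g : ℕ → ℝ) (pj : ℕ → ℝ) (ε : ℕ → ℝ) (η : ℝ) {gk C₁ : ℝ} (hC₁ : 0 < C₁)
    (hgj : ∀ j ∈ J, 0 < g j) (hgk : ∀ j ∈ J, gk ^ 2 = g j ^ 2 * (P.L : ℝ) ^ (k - j)) (hp : ∀ j ∈ J, 0 < pj j)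
    (hgp : ∀ j ∈ J, g j * pj j ≤ 1)
    (hLF : ∀ j ∈ J, ∀ p' ∈ S' j, g j * pj j ≤ dist1 (GaugeField.plaqHol (V j) p'))
    (h8 : ∀ j ∈ J, InSpace (j + 1) (B10Eq71TorusOverlap.Ω M₁ R Ω₀ S) (ε j) η U)
    (hε : ∀ j ∈ J, ε j ≤ C₁ * (g j * pj j))
    (hα3 : ∀ j ∈ J, C0 3 * (2 * C₁ * (g j * pj j)) ≤ 1 / 3) (hα2 : ∀ j ∈ J, 2 * (2 * C₁ * (g j * pj j)) ≤ c2' 3 P.L)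
    (hsmall : ∀ j ∈ J, (2 * C₁ * (64 / 3 * C0 3 * C₁ ^ 2) + (64 / 3 * C0 3 * C₁ ^ 2) ^ 2) / 2 * g j * pj j ≤ 1 / 4) :
    (1 / 4 : ℝ) * ∑ j ∈ J, ∑ _p' ∈ S' j, pj j ^ 2 / 4 ≤
      ((gk ^ 2)⁻¹ * (N : ℝ)) * actionEta k U :=
  quarter_sum_le_actionEta_of_constraint42_regAt M₁ R Ω₀ S hd hR hdiv J hJ hJk S' hS' hS U V h42 g pj ε hC₁ hgj hgk hp hgp hLF
    (fun j hj => (h8 j hj).inSpace2.regAt (Nat.le_succ j)) hε hα3 hα2 hsmall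

end ChainFull

end CovariantDerivative

/-! ## §7 (v1.2) [4] (11) «\overline{U^u} = (Ū)^u» FOR PRINT'S AVERAGING ON THE TORUS, LOCALLY; [7] (3)–(4): THE CONSTRAINT SPACE
## `𝔅_k(𝔅_k, V)` IS INVARIANT UNDER THE GROUP (4); THE SPACE (6) WITH BODY, A UNION OF (4)-ORBITS; §4's `hinv` DISCHARGED

[7] p. 278 (read as image): «… and the space 𝔅_k(𝔅_k, V) by the conditions  Ū^j = V on Λ_j, j = 0, 1, …, k, (3)  where V is a fixed gauge
field configuration define on 𝔅_k. The space U_k({Ω_j}, ε₀) is gauge invariant, and the space 𝔅_k(𝔅_k, V) is invariant with respect to gauge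
transformations u satisfying  u(y) = 1 for y ∈ 𝔅_k. (4)  We consider the functional A(U) = A^η(U) = Σ_{p⊂Ω₀} η^{d−4}[1 − Re tr U(∂p)],
η = L^{−k} (5) on the space of gauge field configurations  U_k({Ω_j}, ε₀) ∩ 𝔅_k(𝔅_k, V) (6)  This space and the action (5) are invariant with
respect to the gauge transformations (4). These transformations form a group and the space (6) is a union of orbits of this group.»
[4] p. 19 (11): «\overline{U^u} = (Ū)^u»; p. 24: «Let us notice that this definition is local in the sense that Ū^k_c, c ⊂ Ω^{(k)}, depends
only on the bond variables U_b for b ⊂ B^k(c₋) ∪ B^k(c₊) … Let us notice also that the property (11) is satisfied» (the cell: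
`B7Prop1Local.avgIter_congr`, `B7AvgGaugeCovariance.avgIter_gaugeAct` — the latter under the GLOBAL regularity (52)).

THIS SECTION: (11) at ONE bond under (52) on its two blocks only (`avgIter_gaugeAct_local`, the clamp device of `B7Prop1Local`), hence for
print's averaging `avgT` on the torus under the scale-`j` plaquette clause of (2) on a block union containing the bond (`avgT_gaugeAct`);
(4) as `Trivial4` and the invariance of `B10Eq42TorusConstraint.Constraint42` = (3)/(42) under it (`constraint42_gaugeAct`); (6) with body
`InSpace6` and its invariance (`inSpace6_gaugeAct`: «a union of orbits»); §4's hypothesis `hinv` for the concrete torus space (8) ∩ 𝔅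
(`hinv_inSpace6`).  The invariance of the action (5) is the cell's `GaugeInvariant` bookkeeping and is not re-derived here. -/

section LocalCovariance

open B7Prop1Explicit renaming Site → LSite
open B7Prop1Explicit (e U1)
open B7Prop2Explicit (avgIter pdev AvgClosed hol_plaqWord_self)
open B7Prop1Local (InBox AgreeOn PlaqIn clamp clampCfg clamp_of_inBox clamp_add_e_of clamp_add_e_of_not clampCfg_agree clampCfg_mem
  loK bondHiK avgIter_congr pdevOn pdev_clampCfg_le)
open B7AvgGaugeCovariance (uLev uLev_apply avgIter_gaugeAct)

variable {d : ℕ}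

/-- **The clamped extension of a gauge transform is a gauge transform of the clamped extension**: `π^*(V^u) = (π^*V)^{u∘π}` — on a
genuine bond of the box `π(x + e_κ) = π(x) + e_κ` (`clamp_add_e_of`), on a degenerate one both sides are `1` (`clamp_add_e_of_not`).  The
algebraic step that localises (11). [cite: Balaban1985Averaging, (11) p.19, p.24 (locality sentence after (43))] -/
theorem clampCfg_gaugeAct {G : Type*} [Group G] {lo hi : LSite d} (hlohi : ∀ i, lo i ≤ hi i) (u : LSite d → G)
    (V : LSite d → Fin d → G) :
    clampCfg lo hi (B7Prop1Explicit.gaugeAct u V) = B7Prop1Explicit.gaugeAct (fun x => u (clamp lo hi x)) (clampCfg lo hi V) := by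
  funext x κ
  by_cases h : lo κ ≤ x κ ∧ x κ < hi κ
  · simp only [clampCfg, B7Prop1Explicit.gaugeAct, if_pos h, clamp_add_e_of h]
  · simp only [clampCfg, B7Prop1Explicit.gaugeAct, if_neg h, clamp_add_e_of_not (hlohi κ) h, mul_one, mul_inv_cancel]

variable {𝔸 : Type*} [NormedRing 𝔸] [NormOneClass 𝔸] [NormedAlgebra ℂ 𝔸] [CompleteSpace 𝔸]

/-- The base points `L^j q` and `L^j(q + e_κ)` of the two blocks of the bond `c = ⟨q, q + e_κ⟩` lie in the box `[L^j q, L^j q + (L^j − 1)𝟙 +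
L^j e_κ]` (`B7Prop1Local.loK` / `bondHiK`). [cite: Balaban1985Averaging, p.24 (locality sentence after (43))] -/
theorem inBox_bond_corners {L : ℕ} (hL : 1 ≤ L) (j : ℕ) (q : LSite d) (κ : Fin d) :
    InBox (loK L j q) (bondHiK L j q κ) (((L : ℤ) ^ j) • q) ∧ InBox (loK L j q) (bondHiK L j q κ) (((L : ℤ) ^ j) • (q + e κ)) := by
  have hP : (1 : ℤ) ≤ (L : ℤ) ^ j := one_le_pow₀ (by exact_mod_cast hL)
  refine ⟨fun i => ?_, fun i => ?_⟩
  · simp only [loK, bondHiK, Pi.smul_apply, smul_eq_mul]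
    split_ifs <;> constructor <;> nlinarith
  · simp only [loK, bondHiK, Pi.smul_apply, Pi.add_apply, smul_eq_mul, B7Prop1Explicit.e_apply]
    split_ifs <;> constructor <;> nlinarith

/-- **[4] (11) AT ONE BOND, LOCALLY**: for the `j`-fold average (43) at the bond `c = ⟨q, q + e_κ⟩` of the `j`-lattice,
`\overline{(U^u)}^j_c = u(L^j c₋) Ū^j_c u(L^j c₊)⁻¹` as soon as `U` (values in an `AvgClosed` gauge group `G`, e.g. `U(N)`) satisfies the
regularity (52) «|U(∂p) − 1| < α₀L^{−2j}» on the plaquettes INSIDE the two blocks `B^j(c₋) ∪ B^j(c₊)` only (`pdevOn`), with [4] Prop. 2's smallness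
of `α₀`.  Proof: the cell's global (11) `B7AvgGaugeCovariance.avgIter_gaugeAct` for the clamped extension `π^*U` (regular everywhere,
`pdev_clampCfg_le`), `π^*(U^u) = (π^*U)^{u∘π}` (`clampCfg_gaugeAct`) and the locality of (43) (`avgIter_congr`).
[cite: Balaban1985Averaging, (11) p.19, p.24 («Let us notice also that the property (11) is satisfied»), p.26 (sentence after (54))] -/
theorem avgIter_gaugeAct_local (L : ℕ) (hL : 2 ≤ L) {G : Subgroup 𝔸ˣ} (hG : AvgClosed d L G) (j : ℕ)
    (V : LSite d → Fin d → 𝔸ˣ) (hV : ∀ x κ, V x κ ∈ G) {u : LSite d → 𝔸ˣ} (hu : ∀ x, u x ∈ U1 𝔸)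
    {α₀ : ℝ} (hα : 0 < α₀) (hα3 : C0 d * α₀ ≤ 1 / 3) (hα2 : 2 * α₀ ≤ c2' d L) (q : LSite d) (κ : Fin d)
    (h52 : pdevOn (loK L j q) (bondHiK L j q κ) V < α₀ * (((L : ℝ) ^ j)⁻¹) ^ 2) :
    avgIter L (B7Prop1Explicit.gaugeAct u V) j q κ =
      u (((L : ℤ) ^ j) • q) * avgIter L V j q κ * (u (((L : ℤ) ^ j) • (q + e κ)))⁻¹ := by
  have hL1 : 1 ≤ L := le_trans (by norm_num) hL
  have hP : (1 : ℤ) ≤ (L : ℤ) ^ j := one_le_pow₀ (by exact_mod_cast hL1)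
  have hlohi : ∀ i, loK L j q i ≤ bondHiK L j q κ i := fun i => by
    simp only [loK, bondHiK]; split_ifs <;> linarith
  have hVU : ∀ x κ, V x κ ∈ U1 𝔸 := fun x κ => hG.le_U1 (hV x κ)
  have h52' : pdev (clampCfg (loK L j q) (bondHiK L j q κ) V) < α₀ * (((L : ℝ) ^ j)⁻¹) ^ 2 :=
    (pdev_clampCfg_le hlohi hVU).trans_lt h52
  have hcov := avgIter_gaugeAct L hL hG j (clampCfg (loK L j q) (bondHiK L j q κ) V) (clampCfg_mem hV)
    (u := fun x => u (clamp (loK L j q) (bondHiK L j q κ) x)) (fun x => hu _) hα hα3 hα2 h52' j le_rfl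
  obtain ⟨hin₀, hin₁⟩ := inBox_bond_corners (d := d) hL1 j q κ
  rw [avgIter_congr L hL1 j q κ (clampCfg_agree (B7Prop1Explicit.gaugeAct u V)).symm, clampCfg_gaugeAct hlohi, hcov,
    avgIter_congr L hL1 j q κ (clampCfg_agree V).symm]
  simp only [B7Prop1Explicit.gaugeAct, uLev_apply, clamp_of_inBox hin₀, clamp_of_inBox hin₁]

end LocalCovariance

/-! ### §7.2 (11) for print's averaging `avgT` on the torus, under the scale-`j` plaquette clause of (2) -/

section TorusCovariance

open scoped Matrix.Norms.L2Operator
open B7Prop1Explicit renaming Site → LSite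
open B7Prop1Explicit (e U1)
open B7Prop2Explicit (avgIter unitaryUnits mem_unitaryUnits unitaryUnits_le_U1 avgClosed_unitaryUnits hol_plaqWord_self)
open B7Prop1Local (InBox PlaqIn loK bondHiK pdevOn)
open B10Eq27TorusAxialLog (transl transl_zero pull hol_pull gaugeActT pull_gaugeActT unitsField unitsField_mem_unitaryUnits h13_unitsField)
open B10Eq69TorusPullback (avgT_apply fine_shift)
open B10Eq71TorusLocal (blockIter_transl_fine)
open B10Eq42TorusConstraint (bondsIn mem_bondsIn_iff)
open B5Ineq137Torus (fine)

variable {j : ℕ} {N : ℕ}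

/-- **A point of the box of the bond `c = ⟨c₋, c₋ + e_κ⟩` of `T^{(j)}` lies in `B^j(c₋) ∪ B^j(c₊)`**, hence in any union of `L^j`-blocks `X`
containing both endpoints (`c ∈ bondsIn j X`): for `0 ≤ w ≤ (L^j − 1)𝟙 + L^j e_κ`, the `j`-block of `x(c₋) + w` is `c₋` or `c₊`
(`B10Eq71TorusLocal.blockIter_transl_fine`, the label identity of gen 56; standing range `j ≤ m + K`). [cite: Balaban1985Averaging, p.24 (locality sentence after (43)); Balaban1985UV3, (39) p.266] -/
theorem transl_fine_mem_of_bondBox (hj : j ≤ P.m + P.K) {X : Set (Site P 0)} (hX : IsBlockUnion (P.L ^ j) X) {b : PBond P j}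
    (hb : b ∈ bondsIn j X) {w : LSite P.d} (hw : InBox (loK P.L j 0) (bondHiK P.L j 0 b.dir) w) :
    transl (fine P j b.src) w ∈ X := by
  have hLj : 0 < P.L ^ j := pow_pos P.L_pos j
  have hcast : ((P.L : ℤ) ^ j) = ((P.L ^ j : ℕ) : ℤ) := by push_cast; rfl
  have hw0 : ∀ κ, 0 ≤ w κ := fun κ => by
    have h := (hw κ).1; simp only [loK, Pi.zero_apply, mul_zero] at h; exact h
  have hwle : ∀ κ, (w κ).toNat ≤ P.L ^ j - 1 + (if κ = b.dir then P.L ^ j else 0) := fun κ => by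
    have h := (hw κ).2
    simp only [bondHiK, Pi.zero_apply, mul_zero, zero_add, hcast] at h
    have h0 := hw0 κ
    split_ifs at h with hκ
    · rw [if_pos hκ]; omega
    · rw [if_neg hκ]; omega
  have hblk := blockIter_transl_fine hj b.src hw0
  -- the quotient ⌊w_κ / L^j⌋ is 0 off the bond direction and 0 or 1 along it
  have hq0 : ∀ κ, κ ≠ b.dir → (w κ).toNat / P.L ^ j = 0 := fun κ hκ => by
    have h := hwle κ; rw [if_neg hκ, add_zero] at h
    exact Nat.div_eq_of_lt (by omega)
  have hq1 : (w b.dir).toNat / P.L ^ j ≤ 1 := by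
    have h := hwle b.dir; rw [if_pos rfl] at h
    have : (w b.dir).toNat < 2 * P.L ^ j := by omega
    have := Nat.div_lt_of_lt_mul (by rwa [mul_comm] at this)
    omega
  rcases Nat.le_one_iff_eq_zero_or_eq_one.mp hq1 with hz | ho
  · -- the point lies in `B^j(c₋)`
    have hc : blockIter j (transl (fine P j b.src) w) = b.src := by
      rw [hblk]; funext κ
      by_cases hκ : κ = b.dir
      · subst hκ; rw [hz, Nat.cast_zero, add_zero]
      · rw [hq0 κ hκ, Nat.cast_zero, add_zero]
    exact (hX ((blockIter_eq_iff_cubeIdx hj _ _).mp hc)).mpr (mem_bondsIn_iff.mp hb).1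
  · -- the point lies in `B^j(c₊)`
    have hc : blockIter j (transl (fine P j b.src) w) = b.src.shift b.dir := by
      rw [hblk]; funext κ
      rw [Site.shift_apply]
      by_cases hκ : κ = b.dir
      · subst hκ; rw [ho, Nat.cast_one, if_pos rfl]
      · rw [hq0 κ hκ, Nat.cast_zero, add_zero, if_neg hκ]
    exact (hX ((blockIter_eq_iff_cubeIdx hj _ _).mp hc)).mpr (mem_bondsIn_iff.mp hb).2

variable [NeZero N]

/-- **The local (52) for the pullback at a constraint bond from the scale-`j` clause of (2)**: if every fine plaquette touching the block
union `X` has `dist1 ≤ θ` (`θ ≥ 0`) and `c ∈ bondsIn j X`, then `pdevOn` of the pullback `U♯_{x(c₋)}` over the box of the bond is `≤ θ`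
(both orientations through `h13_unitsField`, gen 54; degenerate words transport to `1`). [cite: Balaban1985Averaging, (52) p.26, p.24; Balaban1985Variational, (2) p.278] -/
theorem pdevOn_pull_bond_le (hj : j ≤ P.m + P.K) {X : Set (Site P 0)} (hX : IsBlockUnion (P.L ^ j) X)
    (U : GaugeField P 0 (Matrix.unitaryGroup (Fin N) ℂ)) {θ : ℝ} (hθ : 0 ≤ θ)
    (hreg : ∀ q : Plaq P 0, Touches X q → dist1 (GaugeField.plaqHol U q) ≤ θ) {b : PBond P j} (hb : b ∈ bondsIn j X) :
    pdevOn (loK P.L j 0) (bondHiK P.L j 0 b.dir) (pull (unitsField U) (fine P j b.src)) ≤ θ := by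
  have h13 := h13_unitsField (lo := loK P.L j 0) (hi := bondHiK P.L j 0 b.dir) U (fine P j b.src) (α := θ)
    (fun z κ μ hκμ hp => hreg _ (touches_of_src_mem (transl_fine_mem_of_bondBox hj hX hb hp.1)))
  unfold B7Prop1Local.pdevOn
  refine Real.iSup_le (fun q => ?_) hθ
  obtain ⟨⟨z, κ, μ⟩, hq⟩ := q
  dsimp only
  rcases eq_or_ne κ μ with rfl | hne
  · rw [hol_plaqWord_self]
    simp [hθ]
  · rw [hol_pull]
    exact h13 z κ μ hne hq

/-- **[4] (11) «\overline{U^u} = (Ū)^u» FOR PRINT'S AVERAGING `Ū^j = avgT j U` ON THE TORUS**: if the `U(N)`-valued `U` has `|U(∂q) − 1| ≤ θ`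
on every fine plaquette touching a union `X` of `L^j`-blocks, `θ < ε₀L^{−2j}` with [4] Prop. 2's smallness of `ε₀`, then at every bond `c` of
`T^{(j)}` with both endpoints in `X`:  **`\overline{(U^u)}^j_c = u(x(c₋)) · Ū^j_c · u(x(c₊))⁻¹`**, `x(c) = L^j·c` the base corner of `B^j(c)`
where (43) is anchored (`fine P j c`).  = `avgIter_gaugeAct_local` for the pullback + `pull_gaugeActT` + `fine_shift`.
[cite: Balaban1985Averaging, (11) p.19, (43) p.24, (45) p.24; Balaban1985Variational, (2) p.278] -/
theorem avgT_gaugeAct (hj : j ≤ P.m + P.K) {X : Set (Site P 0)} (hX : IsBlockUnion (P.L ^ j) X)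
    (U : GaugeField P 0 (Matrix.unitaryGroup (Fin N) ℂ)) {ε₀ θ : ℝ} (hε : 0 < ε₀) (hε3 : C0 P.d * ε₀ ≤ 1 / 3)
    (hε2 : 2 * ε₀ ≤ c2' P.d P.L) (hθ : 0 ≤ θ) (hθε : θ < ε₀ * (((P.L : ℝ) ^ j)⁻¹) ^ 2)
    (hreg : ∀ q : Plaq P 0, Touches X q → dist1 (GaugeField.plaqHol U q) ≤ θ)
    (u : GaugeTransf P 0 (Matrix.unitaryGroup (Fin N) ℂ)) {b : PBond P j} (hb : b ∈ bondsIn j X) :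
    avgT j (GaugeField.gaugeAct u U) b =
      Unitary.toUnits (u (fine P j b.src)) * avgT j U b * (Unitary.toUnits (u (fine P j b.tgt)))⁻¹ := by
  letI : CStarAlgebra (Matrix (Fin N) (Fin N) ℂ) := B10Eq29TubeLine.cstarAlgebraMatrix N
  have hV : ∀ x κ, pull (unitsField U) (fine P j b.src) x κ ∈ unitaryUnits (Matrix (Fin N) (Fin N) ℂ) :=
    fun x κ => unitsField_mem_unitaryUnits U _
  have hu : ∀ z : LSite P.d, Unitary.toUnits (u (transl (fine P j b.src) z)) ∈ U1 (Matrix (Fin N) (Fin N) ℂ) :=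
    fun z => unitaryUnits_le_U1 (mem_unitaryUnits.mpr (u _).2)
  have h52 : pdevOn (loK P.L j 0) (bondHiK P.L j 0 b.dir) (pull (unitsField U) (fine P j b.src)) <
      ε₀ * (((P.L : ℝ) ^ j)⁻¹) ^ 2 :=
    (pdevOn_pull_bond_le hj hX U hθ hreg hb).trans_lt hθε
  have hcov := avgIter_gaugeAct_local P.L P.hL.2 (avgClosed_unitaryUnits P.d P.L) j (pull (unitsField U) (fine P j b.src)) hV
    (u := fun z => Unitary.toUnits (u (transl (fine P j b.src) z))) hu hε hε3 hε2 0 b.dir h52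
  rw [avgT_apply, avgT_apply, unitsField_gaugeAct, pull_gaugeActT, hcov]
  simp only [smul_zero, zero_add, transl_zero, ← fine_shift hj]
  rfl

/-- The same from §1's strict clause `RegAt j X ε U` with any `ε < ε₀` obeying the smallness (the form (2)/(68) deliver).
[cite: Balaban1985Averaging, (11) p.19; Balaban1985Variational, (2) p.278] -/
theorem avgT_gaugeAct_of_regAt (hj : j ≤ P.m + P.K) {X : Set (Site P 0)} (hX : IsBlockUnion (P.L ^ j) X)
    (U : GaugeField P 0 (Matrix.unitaryGroup (Fin N) ℂ)) {ε ε₀ : ℝ} (hε0 : 0 ≤ ε) (hεε : ε < ε₀) (hε3 : C0 P.d * ε₀ ≤ 1 / 3)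
    (hε2 : 2 * ε₀ ≤ c2' P.d P.L) (hU : RegAt j X ε U)
    (u : GaugeTransf P 0 (Matrix.unitaryGroup (Fin N) ℂ)) {b : PBond P j} (hb : b ∈ bondsIn j X) :
    avgT j (GaugeField.gaugeAct u U) b =
      Unitary.toUnits (u (fine P j b.src)) * avgT j U b * (Unitary.toUnits (u (fine P j b.tgt)))⁻¹ := by
  have hL : (0 : ℝ) < (((P.L : ℝ) ^ j)⁻¹) ^ 2 := by have := P.L_pos; positivity
  exact avgT_gaugeAct hj hX U (hε0.trans_lt hεε) hε3 hε2 (mul_nonneg hε0 hL.le) (mul_lt_mul_of_pos_right hεε hL)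
    (fun q hq => (hU q hq).le) u hb

end TorusCovariance

/-! ### §7.3 [7] (4) and the invariance of the constraint space `𝔅_k(𝔅_k, V)` = (3) = (42) -/

section Group4

open scoped Matrix.Norms.L2Operator
open B10Eq42TorusConstraint (bondsIn mem_bondsIn_iff bondsIn_mono Constraint42)
open B5Ineq137Torus (fine)

variable {N : ℕ}

/-- **[7] (4) «u(y) = 1 for y ∈ 𝔅_k» ON THE TORUS**: the gauge transformation is trivial at the ANCHOR `x(c) = fine P j c` (the base corner of
`B^j(c)`, where the average (43) and hence the constraint (3)/(42) see `u`, cf. `avgT_gaugeAct`) of every coarse point `c ∈ T^{(j)}` lying in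
`Λ_j` (`toFine j c ∈ Λ_j`, the membership reading of `B10Eq42TorusConstraint.bondsIn`), for every `j ≤ k`. [cite: Balaban1985Variational, (4) p.278] -/
def Trivial4 (k : ℕ) (Λ : ℕ → Set (Site P 0)) (u : GaugeTransf P 0 (Matrix.unitaryGroup (Fin N) ℂ)) : Prop :=
  ∀ j, j ≤ k → ∀ c : Site P j, toFine j c ∈ Λ j → u (fine P j c) = 1

/-- The trivial gauge transformation satisfies (4). [cite: Balaban1985Variational, (4) p.278] -/
theorem trivial4_one (k : ℕ) (Λ : ℕ → Set (Site P 0)) : Trivial4 k Λ (fun _ => (1 : Matrix.unitaryGroup (Fin N) ℂ)) :=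
  fun _ _ _ _ => rfl

/-- (4) is stable under pointwise products («These transformations form a group», [7] p. 278). [cite: Balaban1985Variational, (4) p.278] -/
theorem Trivial4.mul {k : ℕ} {Λ : ℕ → Set (Site P 0)} {u v : GaugeTransf P 0 (Matrix.unitaryGroup (Fin N) ℂ)} (hu : Trivial4 k Λ u)
    (hv : Trivial4 k Λ v) : Trivial4 k Λ (fun x => u x * v x) := fun j hj c hc => by
  simp only [hu j hj c hc, hv j hj c hc, mul_one]

/-- (4) is stable under pointwise inverses («These transformations form a group»). [cite: Balaban1985Variational, (4) p.278] -/
theorem Trivial4.inv {k : ℕ} {Λ : ℕ → Set (Site P 0)} {u : GaugeTransf P 0 (Matrix.unitaryGroup (Fin N) ℂ)} (hu : Trivial4 k Λ u) :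
    Trivial4 k Λ (fun x => (u x)⁻¹) := fun j hj c hc => by
  simp only [hu j hj c hc, inv_one]

/-- (4) for fewer levels / smaller regions. [cite: Balaban1985Variational, (4) p.278] -/
theorem Trivial4.mono {k k' : ℕ} (hk : k' ≤ k) {Λ Λ' : ℕ → Set (Site P 0)} (hΛ : ∀ j, j ≤ k' → Λ' j ⊆ Λ j)
    {u : GaugeTransf P 0 (Matrix.unitaryGroup (Fin N) ℂ)} (hu : Trivial4 k Λ u) : Trivial4 k' Λ' u :=
  fun j hj c hc => hu j (hj.trans hk) c (hΛ j hj hc)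

variable [NeZero N]

/-- **[7] p. 278 «the space 𝔅_k(𝔅_k, V) is invariant with respect to gauge transformations u satisfying (4)» ON THE TORUS**: for a `U(N)`-valued
`U` in the plaquette half of `U_k({Ω_j}, ε)` (§1 `InSpace2`; `ε < ε₀`, [4] Prop. 2's smallness of `ε₀`), regions `Λ_j ⊆ Ω_j` with `Ω_j` a union
of `L^j`-blocks (`j ≤ k ≤ m + K`), and `u` satisfying (4) on `{Λ_j}`:  `U ∈ 𝔅_k(𝔅_k, V) ⇒ U^u ∈ 𝔅_k(𝔅_k, V)` (`Constraint42` of the (42) file,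
print's (3)).  Proof: (11) at each constraint bond (`avgT_gaugeAct_of_regAt`) and `u = 1` at both anchors. [cite: Balaban1985Variational, (3)–(4) p.278; Balaban1985UV3, (42) p.266] -/
theorem constraint42_gaugeAct {k : ℕ} (hk : k ≤ P.m + P.K) {Ω Λ : ℕ → Set (Site P 0)} (hΩ : ∀ j, j ≤ k → IsBlockUnion (P.L ^ j) (Ω j))
    (hΛΩ : ∀ j, j ≤ k → Λ j ⊆ Ω j) {ε ε₀ : ℝ} (hε0 : 0 ≤ ε) (hεε : ε < ε₀) (hε3 : C0 P.d * ε₀ ≤ 1 / 3) (hε2 : 2 * ε₀ ≤ c2' P.d P.L)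
    {U : GaugeField P 0 (Matrix.unitaryGroup (Fin N) ℂ)} (hU : InSpace2 k Ω ε U)
    {u : GaugeTransf P 0 (Matrix.unitaryGroup (Fin N) ℂ)} (hu : Trivial4 k Λ u)
    {V : (j : ℕ) → GaugeField P j (Matrix.unitaryGroup (Fin N) ℂ)} (h42 : Constraint42 k Λ V U) :
    Constraint42 k Λ V (GaugeField.gaugeAct u U) := by
  intro j hj b hb
  have hbΩ : b ∈ bondsIn j (Ω j) := bondsIn_mono (hΛΩ j hj) hb
  have h₁ : u (fine P j b.src) = 1 := hu j hj b.src (mem_bondsIn_iff.mp hb).1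
  have h₂ : u (fine P j b.tgt) = 1 := hu j hj b.tgt (mem_bondsIn_iff.mp hb).2
  rw [avgT_gaugeAct_of_regAt (hj.trans hk) (hΩ j hj) U hε0 hεε hε3 hε2 (hU j hj) u hbΩ, h₁, h₂]
  simp only [map_one, inv_one, one_mul, mul_one]
  exact h42 j hj b hb

end Group4

/-! ### §7.4 The space (6) with body, its invariance under (4), and §4's `hinv` for the concrete torus space -/

section Space6

open scoped Matrix.Norms.L2Operator
open B10Eq42TorusConstraint (Constraint42)

variable {N : ℕ}

/-- **[7] (6) WITH BODY ON THE TORUS**: `U ∈ U_k({Ω_j}, ε₀) ∩ 𝔅_k(𝔅_k, V)` — both clauses of (2) (`InSpace`, §6) and the constraint (3)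
(`Constraint42` of the (42) file for the data `V_j` on `Λ_j`). [cite: Balaban1985Variational, (6) p.278, (2)–(3) p.278] -/
def InSpace6 (k : ℕ) (Ω Λ : ℕ → Set (Site P 0)) (ε₀ η : ℝ) (V : (j : ℕ) → GaugeField P j (Matrix.unitaryGroup (Fin N) ℂ))
    (U : GaugeField P 0 (Matrix.unitaryGroup (Fin N) ℂ)) : Prop :=
  InSpace k Ω ε₀ η U ∧ Constraint42 k Λ V U

/-- The two halves of (6). [cite: Balaban1985Variational, (6) p.278] -/
theorem inSpace6_iff {k : ℕ} {Ω Λ : ℕ → Set (Site P 0)} {ε₀ η : ℝ} {V : (j : ℕ) → GaugeField P j (Matrix.unitaryGroup (Fin N) ℂ)}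
    {U : GaugeField P 0 (Matrix.unitaryGroup (Fin N) ℂ)} : InSpace6 k Ω Λ ε₀ η V U ↔ InSpace k Ω ε₀ η U ∧ Constraint42 k Λ V U :=
  Iff.rfl

variable [NeZero N]

/-- **NON-VACUITY of (6)**: the trivial configuration lies in (6) for the trivial data (`ε₀ > 0`, `η > 0`). [cite: Balaban1985Variational, (6) p.278] -/
theorem inSpace6_one (k : ℕ) (Ω Λ : ℕ → Set (Site P 0)) {ε₀ η : ℝ} (hε : 0 < ε₀) (hη : 0 < η) :
    InSpace6 k Ω Λ ε₀ η (fun j => (1 : GaugeField P j (Matrix.unitaryGroup (Fin N) ℂ)))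
      (1 : GaugeField P 0 (Matrix.unitaryGroup (Fin N) ℂ)) :=
  ⟨inSpace_one k Ω hε hη, B10Eq42TorusConstraint.constraint42_one k Λ⟩

/-- **[7] p. 278 «This space … [is] invariant with respect to the gauge transformations (4) … the space (6) is a union of orbits of this
group» ON THE TORUS**: for `ε₀` obeying [4] Prop. 2's smallness (with room: `ε₀ < ε₁`, `C₀ε₁ ≤ ⅓`, `2ε₁ ≤ c₂′`), `Λ_j ⊆ Ω_j` unions of
`L^j`-blocks (`k ≤ m + K`) and `u` satisfying (4):  `U ∈ (6) ⇒ U^u ∈ (6)` — the full space (2) by §6's `inSpace_gaugeAct_iff`, the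
constraint (3) by `constraint42_gaugeAct`. [cite: Balaban1985Variational, (6), (4) p.278] -/
theorem inSpace6_gaugeAct {k : ℕ} (hk : k ≤ P.m + P.K) {Ω Λ : ℕ → Set (Site P 0)} (hΩ : ∀ j, j ≤ k → IsBlockUnion (P.L ^ j) (Ω j))
    (hΛΩ : ∀ j, j ≤ k → Λ j ⊆ Ω j) {ε₀ ε₁ η : ℝ} (hε0 : 0 ≤ ε₀) (hε01 : ε₀ < ε₁) (hε3 : C0 P.d * ε₁ ≤ 1 / 3)
    (hε2 : 2 * ε₁ ≤ c2' P.d P.L) {V : (j : ℕ) → GaugeField P j (Matrix.unitaryGroup (Fin N) ℂ)}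
    {U : GaugeField P 0 (Matrix.unitaryGroup (Fin N) ℂ)} (hU : InSpace6 k Ω Λ ε₀ η V U)
    {u : GaugeTransf P 0 (Matrix.unitaryGroup (Fin N) ℂ)} (hu : Trivial4 k Λ u) :
    InSpace6 k Ω Λ ε₀ η V (GaugeField.gaugeAct u U) :=
  ⟨(inSpace_gaugeAct_iff u U).mpr hU.1, constraint42_gaugeAct hk hΩ hΛΩ hε0 hε01 hε3 hε2 hU.1.inSpace2 hu hU.2⟩

/-- **«the space (6) is a union of orbits of this group»**: membership in (6) is CONSTANT along (4)-orbits (`u` and `u⁻¹` both satisfy (4)).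
[cite: Balaban1985Variational, p.278 (sentence after (6))] -/
theorem inSpace6_gaugeAct_iff {k : ℕ} (hk : k ≤ P.m + P.K) {Ω Λ : ℕ → Set (Site P 0)} (hΩ : ∀ j, j ≤ k → IsBlockUnion (P.L ^ j) (Ω j))
    (hΛΩ : ∀ j, j ≤ k → Λ j ⊆ Ω j) {ε₀ ε₁ η : ℝ} (hε0 : 0 ≤ ε₀) (hε01 : ε₀ < ε₁) (hε3 : C0 P.d * ε₁ ≤ 1 / 3)
    (hε2 : 2 * ε₁ ≤ c2' P.d P.L) {V : (j : ℕ) → GaugeField P j (Matrix.unitaryGroup (Fin N) ℂ)}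
    (U : GaugeField P 0 (Matrix.unitaryGroup (Fin N) ℂ)) {u : GaugeTransf P 0 (Matrix.unitaryGroup (Fin N) ℂ)} (hu : Trivial4 k Λ u) :
    InSpace6 k Ω Λ ε₀ η V (GaugeField.gaugeAct u U) ↔ InSpace6 k Ω Λ ε₀ η V U := by
  refine ⟨fun h => ?_, fun h => inSpace6_gaugeAct hk hΩ hΛΩ hε0 hε01 hε3 hε2 h hu⟩
  have hback : GaugeField.gaugeAct (fun x => (u x)⁻¹) (GaugeField.gaugeAct u U) = U := by
    funext b
    simp only [GaugeField.gaugeAct, inv_inv]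
    group
  rw [← hback]
  exact inSpace6_gaugeAct hk hΩ hΛΩ hε0 hε01 hε3 hε2 h hu.inv

/-- **§4's HYPOTHESIS `hinv` («(8) is gauge invariant») DISCHARGED FOR THE CONCRETE TORUS SPACE**: with `rel U U′ :⟺ U = (U′)^u` for some
`u` satisfying (4), and the level-`(j+1)` space of a datum `y` read as (6) for that datum's regions and data (`R8 y ⊆`-free: `R8 y = (6)_y`),
`rel U U′ → U′ ∈ R8 y → U ∈ R8 y` — the shape `mem_space8_of_crit_nested` / `regAt_of_crit_nested` take as `hinv`.
[cite: Balaban1985Variational, (4), (6), (8) pp.278–279; Balaban1985UV3, (68) p.273] -/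
theorem hinv_inSpace6 {Y : Type*} {k : ℕ} (hk : k ≤ P.m + P.K) (Ω Λ : Y → ℕ → Set (Site P 0))
    (hΩ : ∀ y j, j ≤ k → IsBlockUnion (P.L ^ j) (Ω y j)) (hΛΩ : ∀ y j, j ≤ k → Λ y j ⊆ Ω y j) {ε₀ ε₁ η : ℝ} (hε0 : 0 ≤ ε₀)
    (hε01 : ε₀ < ε₁) (hε3 : C0 P.d * ε₁ ≤ 1 / 3) (hε2 : 2 * ε₁ ≤ c2' P.d P.L)
    (V : Y → (j : ℕ) → GaugeField P j (Matrix.unitaryGroup (Fin N) ℂ)) :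
    ∀ (y : Y) (U U' : GaugeField P 0 (Matrix.unitaryGroup (Fin N) ℂ)),
      (∃ u : GaugeTransf P 0 (Matrix.unitaryGroup (Fin N) ℂ), Trivial4 k (Λ y) u ∧ U = GaugeField.gaugeAct u U') →
        U' ∈ {W | InSpace6 k (Ω y) (Λ y) ε₀ η (V y) W} → U ∈ {W | InSpace6 k (Ω y) (Λ y) ε₀ η (V y) W} := by
  rintro y U U' ⟨u, hu, rfl⟩ hU'
  exact inSpace6_gaugeAct hk (hΩ y) (hΛΩ y) hε0 hε01 hε3 hε2 hU' hu

end Space6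

end Literature.MathematicalPhysics.QuantumFieldTheory.Balaban1983to89.B10Eq68TorusRegularity
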